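import Literature.Computability.Complexity.StackUnary
import HarnessLib

/-!
# The preprocessing of Liu–Pass's padding distinguisher is polynomial time (a stack program)

Trunk `CplxCore` toolkit entry (structured stack programs `Com` of `StackPrograms.lean`,
`Com.mem_FP`; style of `BinarySubtraction.lean` / `StackArith.lean`), serving the efficiency fact
`Literature.Computability.Cryptography.lpAdvRun_polyTime` of `LiuPassPadding.lean` (the deterministic core of the
padding distinguisher in the tree's proof of Liu–Pass, FOCS 2020, Thm 5.2 with the padding of
Thms 5.5–5.6; discharged in `LiuPassPaddingProofs.lean`). That core, on input `⟨1ⁿ, y⟩` — in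
general `⟨a, y⟩` with `n = |a|` — and coins `r` (`C = |r|`), computes from polynomials `Q, K`
and `γ`

  `t = (Q(n) - γ - 1 + ⌊(C - Q(n+1)) / K(n)⌋) - n`,  `κ = (C - Q(n+1)) mod K(n)`  (conventions of `ℕ`:
  truncated subtraction, `m / 0 = 0`, `m mod 0 = m`),

the padded sample `x = y ‖ r ↾ t`, the coins `ρ = r ⇂ (C - κ)` of the heuristic and the threshold
`|x| - 3⌊log₂ n⌋`, and accepts iff `ℋ(x; ρ) ≥ |x| - 3⌊log₂ n⌋`. This file provides everything
before the call of `ℋ` as **one stack program** `LPD.prog γ Q K` on the reassociated input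
`⟨a, ⟨y, r⟩⟩`, with output `⟨1^{|x| - 3⌊log₂ n⌋}, ⟨x, ρ⟩⟩` (threshold in unary, then the query):

* `lpPreFn γ Q K ∈ FP` (`lpPreFn_mem_FP`), `lpPreFn γ Q K ⟨a, ⟨y, r⟩⟩ = ⟨1^{thr}, ⟨x, ρ⟩⟩`
  (`lpPreFn_boolPair`).

All arithmetic is **unary** (every quantity is bounded by the input length or by `Q`, `K` at the
input length plus two), on the generic counters and Horner evaluation of `StackUnary.lean`
(`Com.popK`, `Com.subFrom`, `Com.hornerProg`, `Com.runs_evalPoly`, `Com.pourDbl`, unary words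
`ones n`): registers `LPD.Rg`; phases `parse1` (count `n` three times), `parse2`
(`y` reversed, `|y|`), `scan` (`r` reversed and in order, `C`); Horner evaluation `hornerProg` of
`Q(n)`, `Q(n+1)`, `K(n)` along the coefficient lists (`coeffsHL`, `hornerVal_coeffsHL`) by repeated
addition (`mulN0`, `addN0`); truncated subtractions (`subFrom`, `popK`); division with remainder
by a reloading countdown (`divide`, `divN_eq`, including the `K(n) = 0` branch); the padding
`takeLoop`; `3⌊log₂ n⌋` by repeated halving with fuel `n` (`logLoop`, `logN_snd`,
`Nat.log_div_base`); output assembly (`output`). Every phase has a total functional specification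
and an explicit step bound on explicit register files (`LPD.mk`); the total cost is bounded by the
polynomial `LPD.timePoly γ Q K = 64 (X + Q(X+2) + K(X+2) + deg Q + deg K + γ + 3)⁴`
(`bodyCost_le`).

## References

* Y. Liu, R. Pass, *On one-way functions and Kolmogorov complexity*, FOCS 2020
  (arXiv:2009.11514), proof of Thm 5.2 ("we now construct a PPT distinguisher"), proofs of
  Thms 5.5–5.6 (padding).
* S. Arora, B. Barak, *Computational Complexity: A Modern Approach*, CUP 2009, §1.3 (polynomial
  time is robust; arithmetic in polynomial time), Thm. 2.8 (composition).
* T. Nipkow, G. Klein, *Concrete Semantics*, Springer 2014, Ch. 7–8 (big-step verification style).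
-/

namespace Literature.Computability.Cryptography

open _root_.Computability

namespace LPD

/-- Registers of the preprocessing program: input; three unary copies of `n = |a|` (arithmetic,
fuel and value of the logarithm loop); `y` reversed; `r` reversed and in order; `|r|` in unary;
Horner accumulator, double buffer and scratch; the quantity `t₁` (first `Q(n)`); `K(n)` (then the
coin count `κ`); the division counter; `|x|` in unary (then the threshold); output. [folklore] -/
inductive Rg
  | inp | n0 | nb | nc | yr | r2 | r1 | cn | acc | acc2 | tmp | q0 | kk | cnt | lx | out
  deriving DecidableEq, Fintype

open Complexity.Com

/-- Explicit register files. [folklore] -/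
def mk (zi zn znb znc zy zr2 zr1 zcn za za2 zt zq zk zct zl zo : List Bool) : Complexity.Regs Rg := fun r =>
  match r with
  | .inp => zi | .n0 => zn | .nb => znb | .nc => znc | .yr => zy | .r2 => zr2 | .r1 => zr1 | .cn => zcn
  | .acc => za | .acc2 => za2 | .tmp => zt | .q0 => zq | .kk => zk | .cnt => zct | .lx => zl | .out => zo

section MkLemmas

variable (zi zn znb znc zy zr2 zr1 zcn za za2 zt zq zk zct zl zo x : List Bool)

/-- Reading `inp`. [folklore] -/
@[simp] theorem mk_inp : mk zi zn znb znc zy zr2 zr1 zcn za za2 zt zq zk zct zl zo .inp = zi := rfl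
/-- Reading `n0`. [folklore] -/
@[simp] theorem mk_n0 : mk zi zn znb znc zy zr2 zr1 zcn za za2 zt zq zk zct zl zo .n0 = zn := rfl
/-- Reading `nb`. [folklore] -/
@[simp] theorem mk_nb : mk zi zn znb znc zy zr2 zr1 zcn za za2 zt zq zk zct zl zo .nb = znb := rfl
/-- Reading `nc`. [folklore] -/
@[simp] theorem mk_nc : mk zi zn znb znc zy zr2 zr1 zcn za za2 zt zq zk zct zl zo .nc = znc := rfl
/-- Reading `yr`. [folklore] -/
@[simp] theorem mk_yr : mk zi zn znb znc zy zr2 zr1 zcn za za2 zt zq zk zct zl zo .yr = zy := rfl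
/-- Reading `r2`. [folklore] -/
@[simp] theorem mk_r2 : mk zi zn znb znc zy zr2 zr1 zcn za za2 zt zq zk zct zl zo .r2 = zr2 := rfl
/-- Reading `r1`. [folklore] -/
@[simp] theorem mk_r1 : mk zi zn znb znc zy zr2 zr1 zcn za za2 zt zq zk zct zl zo .r1 = zr1 := rfl
/-- Reading `cn`. [folklore] -/
@[simp] theorem mk_cn : mk zi zn znb znc zy zr2 zr1 zcn za za2 zt zq zk zct zl zo .cn = zcn := rfl
/-- Reading `acc`. [folklore] -/
@[simp] theorem mk_acc : mk zi zn znb znc zy zr2 zr1 zcn za za2 zt zq zk zct zl zo .acc = za := rfl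
/-- Reading `acc2`. [folklore] -/
@[simp] theorem mk_acc2 : mk zi zn znb znc zy zr2 zr1 zcn za za2 zt zq zk zct zl zo .acc2 = za2 := rfl
/-- Reading `tmp`. [folklore] -/
@[simp] theorem mk_tmp : mk zi zn znb znc zy zr2 zr1 zcn za za2 zt zq zk zct zl zo .tmp = zt := rfl
/-- Reading `q0`. [folklore] -/
@[simp] theorem mk_q0 : mk zi zn znb znc zy zr2 zr1 zcn za za2 zt zq zk zct zl zo .q0 = zq := rfl
/-- Reading `kk`. [folklore] -/
@[simp] theorem mk_kk : mk zi zn znb znc zy zr2 zr1 zcn za za2 zt zq zk zct zl zo .kk = zk := rfl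
/-- Reading `cnt`. [folklore] -/
@[simp] theorem mk_cnt : mk zi zn znb znc zy zr2 zr1 zcn za za2 zt zq zk zct zl zo .cnt = zct := rfl
/-- Reading `lx`. [folklore] -/
@[simp] theorem mk_lx : mk zi zn znb znc zy zr2 zr1 zcn za za2 zt zq zk zct zl zo .lx = zl := rfl
/-- Reading `out`. [folklore] -/
@[simp] theorem mk_out : mk zi zn znb znc zy zr2 zr1 zcn za za2 zt zq zk zct zl zo .out = zo := rfl

/-- Updating `inp`. [folklore] -/
@[simp] theorem update_inp : Function.update (mk zi zn znb znc zy zr2 zr1 zcn za za2 zt zq zk zct zl zo) .inp x =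
    mk x zn znb znc zy zr2 zr1 zcn za za2 zt zq zk zct zl zo := by funext r; cases r <;> simp
/-- Updating `n0`. [folklore] -/
@[simp] theorem update_n0 : Function.update (mk zi zn znb znc zy zr2 zr1 zcn za za2 zt zq zk zct zl zo) .n0 x =
    mk zi x znb znc zy zr2 zr1 zcn za za2 zt zq zk zct zl zo := by funext r; cases r <;> simp
/-- Updating `nb`. [folklore] -/
@[simp] theorem update_nb : Function.update (mk zi zn znb znc zy zr2 zr1 zcn za za2 zt zq zk zct zl zo) .nb x =
    mk zi zn x znc zy zr2 zr1 zcn za za2 zt zq zk zct zl zo := by funext r; cases r <;> simp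
/-- Updating `nc`. [folklore] -/
@[simp] theorem update_nc : Function.update (mk zi zn znb znc zy zr2 zr1 zcn za za2 zt zq zk zct zl zo) .nc x =
    mk zi zn znb x zy zr2 zr1 zcn za za2 zt zq zk zct zl zo := by funext r; cases r <;> simp
/-- Updating `yr`. [folklore] -/
@[simp] theorem update_yr : Function.update (mk zi zn znb znc zy zr2 zr1 zcn za za2 zt zq zk zct zl zo) .yr x =
    mk zi zn znb znc x zr2 zr1 zcn za za2 zt zq zk zct zl zo := by funext r; cases r <;> simp
/-- Updating `r2`. [folklore] -/
@[simp] theorem update_r2 : Function.update (mk zi zn znb znc zy zr2 zr1 zcn za za2 zt zq zk zct zl zo) .r2 x =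
    mk zi zn znb znc zy x zr1 zcn za za2 zt zq zk zct zl zo := by funext r; cases r <;> simp
/-- Updating `r1`. [folklore] -/
@[simp] theorem update_r1 : Function.update (mk zi zn znb znc zy zr2 zr1 zcn za za2 zt zq zk zct zl zo) .r1 x =
    mk zi zn znb znc zy zr2 x zcn za za2 zt zq zk zct zl zo := by funext r; cases r <;> simp
/-- Updating `cn`. [folklore] -/
@[simp] theorem update_cn : Function.update (mk zi zn znb znc zy zr2 zr1 zcn za za2 zt zq zk zct zl zo) .cn x =
    mk zi zn znb znc zy zr2 zr1 x za za2 zt zq zk zct zl zo := by funext r; cases r <;> simp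
/-- Updating `acc`. [folklore] -/
@[simp] theorem update_acc : Function.update (mk zi zn znb znc zy zr2 zr1 zcn za za2 zt zq zk zct zl zo) .acc x =
    mk zi zn znb znc zy zr2 zr1 zcn x za2 zt zq zk zct zl zo := by funext r; cases r <;> simp
/-- Updating `acc2`. [folklore] -/
@[simp] theorem update_acc2 : Function.update (mk zi zn znb znc zy zr2 zr1 zcn za za2 zt zq zk zct zl zo) .acc2 x =
    mk zi zn znb znc zy zr2 zr1 zcn za x zt zq zk zct zl zo := by funext r; cases r <;> simp
/-- Updating `tmp`. [folklore] -/
@[simp] theorem update_tmp : Function.update (mk zi zn znb znc zy zr2 zr1 zcn za za2 zt zq zk zct zl zo) .tmp x =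
    mk zi zn znb znc zy zr2 zr1 zcn za za2 x zq zk zct zl zo := by funext r; cases r <;> simp
/-- Updating `q0`. [folklore] -/
@[simp] theorem update_q0 : Function.update (mk zi zn znb znc zy zr2 zr1 zcn za za2 zt zq zk zct zl zo) .q0 x =
    mk zi zn znb znc zy zr2 zr1 zcn za za2 zt x zk zct zl zo := by funext r; cases r <;> simp
/-- Updating `kk`. [folklore] -/
@[simp] theorem update_kk : Function.update (mk zi zn znb znc zy zr2 zr1 zcn za za2 zt zq zk zct zl zo) .kk x =
    mk zi zn znb znc zy zr2 zr1 zcn za za2 zt zq x zct zl zo := by funext r; cases r <;> simp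
/-- Updating `cnt`. [folklore] -/
@[simp] theorem update_cnt : Function.update (mk zi zn znb znc zy zr2 zr1 zcn za za2 zt zq zk zct zl zo) .cnt x =
    mk zi zn znb znc zy zr2 zr1 zcn za za2 zt zq zk x zl zo := by funext r; cases r <;> simp
/-- Updating `lx`. [folklore] -/
@[simp] theorem update_lx : Function.update (mk zi zn znb znc zy zr2 zr1 zcn za za2 zt zq zk zct zl zo) .lx x =
    mk zi zn znb znc zy zr2 zr1 zcn za za2 zt zq zk zct x zo := by funext r; cases r <;> simp
/-- Updating `out`. [folklore] -/
@[simp] theorem update_out : Function.update (mk zi zn znb znc zy zr2 zr1 zcn za za2 zt zq zk zct zl zo) .out x =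
    mk zi zn znb znc zy zr2 zr1 zcn za za2 zt zq zk zct zl x := by funext r; cases r <;> simp

end MkLemmas

/-- The initial register file. [folklore] -/
theorem init_eq (z : List Bool) :
    Complexity.Regs.init Rg.inp z = mk z [] [] [] [] [] [] [] [] [] [] [] [] [] [] [] := by
  funext r; cases r <;> simp [Complexity.Regs.init, mk]

open Complexity.SProg (dbl dbl_cons dbl_nil)

/-- `dbl` of an append, for the bit doubling `SProg.dbl` of `StackMachines.lean` (local copy of
`ShorFactPost.dbl_append` / `DropParamsTM.dbl_append`, which live in files not imported here; to be
hoisted next to `SProg.dbl`). [folklore] -/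
theorem dbl_append (l l' : List Bool) : dbl (l ++ l') = dbl l ++ dbl l' := by
  simp [Complexity.SProg.dbl, List.flatMap_append]

/-- `boolPair x y = dbl x ++ 0 1 y` (local copy of `ShorFactPost.boolPair_eq_dbl`). [folklore] -/
theorem boolPair_eq (x y : List Bool) : Complexity.boolPair x y = dbl x ++ false :: true :: y := by
  simp [Complexity.boolPair, Complexity.SProg.dbl]

/-! #### Register utilities (the counters `popK`, `pushK`, `subFrom`, `pourDbl` are those of `StackUnary.lean`) -/

/-- Two pushes. [folklore] -/
theorem runs_push2 (k1 k2 : Rg) (b1 b2 : Bool) (R : Complexity.Regs Rg) :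
    Runs (push k1 b1 ;; push k2 b2) R
      (Function.update (Function.update R k1 (b1 :: R k1)) k2
        (b2 :: Function.update R k1 (b1 :: R k1) k2)) (1 + 1) :=
  (Runs.push k1 b1 R).seq (Runs.push k2 b2 _)

/-- Three pushes. [folklore] -/
theorem runs_push3 (k1 k2 k3 : Rg) (b1 b2 b3 : Bool) (R : Complexity.Regs Rg) :
    Runs (push k1 b1 ;; push k2 b2 ;; push k3 b3) R
      (Function.update (Function.update (Function.update R k1 (b1 :: R k1)) k2
        (b2 :: Function.update R k1 (b1 :: R k1) k2)) k3
        (b3 :: Function.update (Function.update R k1 (b1 :: R k1)) k2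
          (b2 :: Function.update R k1 (b1 :: R k1) k2) k3)) (1 + (1 + 1)) :=
  (Runs.push k1 b1 R).seq ((Runs.push k2 b2 _).seq (Runs.push k3 b3 _))

/-! #### Scanning the coin block `r` -/

/-- Body of the scan: keep two reversed copies of the bit and count it. [folklore] -/
def scanBody (b : Bool) : Complexity.Com Rg := push .r2 b ;; push .tmp b ;; push .cn true

/-- The scan loop over the rest of the input. [folklore] -/
def scanLoop : Complexity.Com Rg := loop .inp (scanBody true) (scanBody false)

/-- Scan `r`: `r2 := reverse r`, `r1 := r` (via `tmp`), `cn := 1^{|r|}`. [folklore] -/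
def scan : Complexity.Com Rg := scanLoop ;; pour .tmp .r1

/-- **Semantics of the scan loop** (cost `5|w| + 1`). [folklore] -/
theorem runs_scanLoop : ∀ (w zn znb znc zy zr2 zr1 : List Bool) (C : ℕ) (za za2 zt zq zk zct zl zo : List Bool),
    Runs scanLoop (mk w zn znb znc zy zr2 zr1 (Complexity.ones C) za za2 zt zq zk zct zl zo)
      (mk [] zn znb znc zy (w.reverse ++ zr2) zr1 (Complexity.ones (w.length + C)) za za2 (w.reverse ++ zt) zq zk zct zl zo)
      (5 * w.length + 1)
  | [], zn, znb, znc, zy, zr2, zr1, C, za, za2, zt, zq, zk, zct, zl, zo => by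
    have h : Runs scanLoop (mk [] zn znb znc zy zr2 zr1 (Complexity.ones C) za za2 zt zq zk zct zl zo)
        (mk [] zn znb znc zy zr2 zr1 (Complexity.ones C) za za2 zt zq zk zct zl zo) 1 := Runs.loop_nil (k := Rg.inp) _ _ rfl
    simpa using h
  | b :: w, zn, znb, znc, zy, zr2, zr1, C, za, za2, zt, zq, zk, zct, zl, zo => by
    have hbody : Runs (scanBody b) (mk w zn znb znc zy zr2 zr1 (Complexity.ones C) za za2 zt zq zk zct zl zo)
        (mk w zn znb znc zy (b :: zr2) zr1 (Complexity.ones (C + 1)) za za2 (b :: zt) zq zk zct zl zo) (1 + 1 + 1) := by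
      simpa [scanBody, ones_succ] using runs_push3 .r2 .tmp .cn b b true
        (mk w zn znb znc zy zr2 zr1 (Complexity.ones C) za za2 zt zq zk zct zl zo)
    have ih := runs_scanLoop w zn znb znc zy (b :: zr2) zr1 (C + 1) za za2 (b :: zt) zq zk zct zl zo
    rw [show w.length + (C + 1) = (b :: w).length + C by simp; omega,
      show w.reverse ++ b :: zr2 = (b :: w).reverse ++ zr2 by simp,
      show w.reverse ++ b :: zt = (b :: w).reverse ++ zt by simp] at ih
    rw [show 5 * (b :: w).length + 1 = (1 + 1 + 1) + 2 + (5 * w.length + 1) by simp; ring]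
    cases b
    · exact Runs.loop_false' (R := mk (false :: w) zn znb znc zy zr2 zr1 (Complexity.ones C) za za2 zt zq zk zct zl zo) rfl
        (update_inp ..) hbody ih
    · exact Runs.loop_true' (R := mk (true :: w) zn znb znc zy zr2 zr1 (Complexity.ones C) za za2 zt zq zk zct zl zo) rfl
        (update_inp ..) hbody ih

/-- **Semantics of `scan`** on fresh registers (cost `≤ 8|w| + 2`). [folklore] -/
theorem runs_scan (w zn znb znc zy za za2 zq zk zct zl zo : List Bool) :
    Runs scan (mk w zn znb znc zy [] [] [] za za2 [] zq zk zct zl zo)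
      (mk [] zn znb znc zy w.reverse w (Complexity.ones w.length) za za2 [] zq zk zct zl zo) (8 * w.length + 2) := by
  have h1 := runs_scanLoop w zn znb znc zy [] [] 0 za za2 [] zq zk zct zl zo
  simp only [List.append_nil, Nat.add_zero] at h1
  have h2 : Runs (pour .tmp .r1) (mk [] zn znb znc zy w.reverse [] (Complexity.ones w.length) za za2 w.reverse zq zk zct zl zo)
      (mk [] zn znb znc zy w.reverse w (Complexity.ones w.length) za za2 [] zq zk zct zl zo) (3 * w.length + 1) := by
    have := runs_pour (a := Rg.tmp) (b := Rg.r1) (by decide)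
      (mk [] zn znb znc zy w.reverse [] (Complexity.ones w.length) za za2 w.reverse zq zk zct zl zo)
    simpa using this
  exact (h1.seq h2).mono (by omega)

/-! #### Parsing `⟨y, r⟩` -/

/-- Loop body after a first bit `1`: `11` is a bit `1` of `y`; `10` is malformed (ignored). [folklore] -/
def p2T : Complexity.Com Rg := pop .inp (push .yr true ;; push .lx true) skip skip

/-- Loop body after a first bit `0`: `01` is the separator (scan `r`), `00` is a bit `0` of `y`. [folklore] -/
def p2F : Complexity.Com Rg := pop .inp scan (push .yr false ;; push .lx true) skip

/-- The parser of `⟨y, r⟩`. [folklore] -/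
def parse2 : Complexity.Com Rg := loop .inp p2T p2F

/-- Functional semantics of `parse2`: final `yr`, number of units added to `lx`, the string scanned
as `r` (`[]` if the separator is never met). [folklore] -/
def parse2Spec : List Bool → List Bool → ℕ → List Bool × ℕ × List Bool
  | [], Y, L => (Y, L, [])
  | [_], Y, L => (Y, L, [])
  | true :: true :: z, Y, L => parse2Spec z (true :: Y) (L + 1)
  | true :: false :: z, Y, L => parse2Spec z Y L
  | false :: false :: z, Y, L => parse2Spec z (false :: Y) (L + 1)
  | false :: true :: z, Y, L => (Y, L, z)

/-- Recording one bit of `y`. [folklore] -/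
theorem runs_yl (b : Bool) (zi zn znb znc Y zr2 zr1 zcn za za2 zt zq zk zct : List Bool) (L : ℕ)
    (zo : List Bool) :
    Runs (push .yr b ;; push .lx true) (mk zi zn znb znc Y zr2 zr1 zcn za za2 zt zq zk zct (Complexity.ones L) zo)
      (mk zi zn znb znc (b :: Y) zr2 zr1 zcn za za2 zt zq zk zct (Complexity.ones (L + 1)) zo) (1 + 1) := by
  simpa [ones_succ] using runs_push2 .yr .lx b true (mk zi zn znb znc Y zr2 zr1 zcn za za2 zt zq zk zct (Complexity.ones L) zo)

/-- **Semantics of `parse2`** (cost `≤ 8|z| + 3`). [folklore] -/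
theorem runs_parse2 : ∀ (z zn znb znc Y : List Bool) (L : ℕ) (za za2 zq zk zct zo : List Bool),
    Runs parse2 (mk z zn znb znc Y [] [] [] za za2 [] zq zk zct (Complexity.ones L) zo)
      (mk [] zn znb znc (parse2Spec z Y L).1 (parse2Spec z Y L).2.2.reverse (parse2Spec z Y L).2.2
        (Complexity.ones (parse2Spec z Y L).2.2.length) za za2 [] zq zk zct (Complexity.ones (parse2Spec z Y L).2.1) zo)
      (8 * z.length + 3)
  | [], zn, znb, znc, Y, L, za, za2, zq, zk, zct, zo => by
    have h : Runs parse2 (mk [] zn znb znc Y [] [] [] za za2 [] zq zk zct (Complexity.ones L) zo)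
        (mk [] zn znb znc Y [] [] [] za za2 [] zq zk zct (Complexity.ones L) zo) 1 := Runs.loop_nil (k := Rg.inp) _ _ rfl
    simpa [parse2Spec] using h.mono (show 1 ≤ 3 by norm_num)
  | [a], zn, znb, znc, Y, L, za, za2, zq, zk, zct, zo => by
    have hrest : Runs parse2 (mk [] zn znb znc Y [] [] [] za za2 [] zq zk zct (Complexity.ones L) zo)
        (mk [] zn znb znc Y [] [] [] za za2 [] zq zk zct (Complexity.ones L) zo) 1 := Runs.loop_nil _ _ rfl
    simp only [parse2Spec, List.reverse_nil, List.length_nil]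
    refine Runs.mono ?_ (show (0 + 2) + 2 + 1 ≤ 8 * [a].length + 3 by simp)
    cases a
    · exact Runs.loop_false' (w := []) rfl (update_inp ..) (Runs.pop_nil _ _ rfl (Runs.skip _)) hrest
    · exact Runs.loop_true' (w := []) rfl (update_inp ..) (Runs.pop_nil _ _ rfl (Runs.skip _)) hrest
  | true :: true :: z, zn, znb, znc, Y, L, za, za2, zq, zk, zct, zo => by
    have ih := runs_parse2 z zn znb znc (true :: Y) (L + 1) za za2 zq zk zct zo
    simp only [parse2Spec]
    refine Runs.mono ?_ (show (1 + 1 + 2) + 2 + (8 * z.length + 3) ≤ 8 * (true :: true :: z).length + 3 by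
      simp; omega)
    exact Runs.loop_true' rfl (update_inp ..) (Runs.pop_true' _ _ rfl (update_inp ..) (runs_yl ..)) ih
  | true :: false :: z, zn, znb, znc, Y, L, za, za2, zq, zk, zct, zo => by
    have ih := runs_parse2 z zn znb znc Y L za za2 zq zk zct zo
    simp only [parse2Spec]
    refine Runs.mono ?_ (show (0 + 2) + 2 + (8 * z.length + 3) ≤ 8 * (true :: false :: z).length + 3 by
      simp; omega)
    exact Runs.loop_true' rfl (update_inp ..) (Runs.pop_false' _ _ rfl (update_inp ..) (Runs.skip _)) ih
  | false :: false :: z, zn, znb, znc, Y, L, za, za2, zq, zk, zct, zo => by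
    have ih := runs_parse2 z zn znb znc (false :: Y) (L + 1) za za2 zq zk zct zo
    simp only [parse2Spec]
    refine Runs.mono ?_ (show (1 + 1 + 2) + 2 + (8 * z.length + 3) ≤ 8 * (false :: false :: z).length + 3 by
      simp; omega)
    exact Runs.loop_false' rfl (update_inp ..) (Runs.pop_false' _ _ rfl (update_inp ..) (runs_yl ..)) ih
  | false :: true :: z, zn, znb, znc, Y, L, za, za2, zq, zk, zct, zo => by
    have hscan := runs_scan z zn znb znc Y za za2 zq zk zct (Complexity.ones L) zo
    have hrest : Runs parse2 (mk [] zn znb znc Y z.reverse z (Complexity.ones z.length) za za2 [] zq zk zct (Complexity.ones L) zo)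
        (mk [] zn znb znc Y z.reverse z (Complexity.ones z.length) za za2 [] zq zk zct (Complexity.ones L) zo) 1 := Runs.loop_nil _ _ rfl
    simp only [parse2Spec]
    refine Runs.mono ?_ (show ((8 * z.length + 2) + 2) + 2 + 1 ≤ 8 * (false :: true :: z).length + 3 by
      simp; omega)
    exact Runs.loop_false' rfl (update_inp ..) (Runs.pop_true' _ _ rfl (update_inp ..) hscan) hrest

/-- `parse2` on a pair. [folklore] -/
theorem parse2Spec_boolPair : ∀ (y r Y : List Bool) (L : ℕ),
    parse2Spec (Complexity.boolPair y r) Y L = (y.reverse ++ Y, L + y.length, r)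
  | [], r, Y, L => by simp [Complexity.boolPair, parse2Spec]
  | b :: y, r, Y, L => by
    have hcons : Complexity.boolPair (b :: y) r = b :: b :: Complexity.boolPair y r := by simp [Complexity.boolPair]
    rw [hcons]
    cases b
    · rw [parse2Spec, parse2Spec_boolPair y r]
      simp only [List.reverse_cons, List.append_assoc, List.singleton_append, List.length_cons, Prod.mk.injEq,
        true_and]
      exact ⟨by omega, trivial⟩
    · rw [parse2Spec, parse2Spec_boolPair y r]
      simp only [List.reverse_cons, List.append_assoc, List.singleton_append, List.length_cons, Prod.mk.injEq,
        true_and]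
      exact ⟨by omega, trivial⟩

/-- Sizes after `parse2`. [folklore] -/
theorem parse2Spec_le : ∀ (z Y : List Bool) (L : ℕ),
    (parse2Spec z Y L).1.length + (parse2Spec z Y L).2.1 + (parse2Spec z Y L).2.2.length ≤
      Y.length + L + z.length
  | [], Y, L => by simp [parse2Spec]
  | [_], Y, L => by simp [parse2Spec]
  | true :: true :: z, Y, L => by have := parse2Spec_le z (true :: Y) (L + 1); simp [parse2Spec] at this ⊢; omega
  | true :: false :: z, Y, L => by have := parse2Spec_le z Y L; simp [parse2Spec] at this ⊢; omega
  | false :: false :: z, Y, L => by have := parse2Spec_le z (false :: Y) (L + 1); simp [parse2Spec] at this ⊢; omega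
  | false :: true :: z, Y, L => by simp [parse2Spec]; omega

/-! #### Parsing `⟨a, ⟨y, r⟩⟩` -/

/-- One unit of `n = |a|` on each of its three copies. [folklore] -/
def unit3 : Complexity.Com Rg := push .n0 true ;; push .nb true ;; push .nc true

/-- Loop body after a first bit `1`: `11` is a bit of `a`; `10` is malformed (ignored). [folklore] -/
def p1T : Complexity.Com Rg := pop .inp unit3 skip skip

/-- Loop body after a first bit `0`: `01` is the separator (parse `⟨y, r⟩`), `00` is a bit of `a`. [folklore] -/
def p1F : Complexity.Com Rg := pop .inp parse2 unit3 skip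

/-- The parser of `⟨a, ⟨y, r⟩⟩`. [folklore] -/
def parse1 : Complexity.Com Rg := loop .inp p1T p1F

/-- Functional semantics of `parse1`: the count `n` and the string handed to `parse2` (`[]` if the
separator is never met). [folklore] -/
def parse1Spec : List Bool → ℕ → ℕ × List Bool
  | [], N => (N, [])
  | [_], N => (N, [])
  | true :: true :: z, N => parse1Spec z (N + 1)
  | true :: false :: z, N => parse1Spec z N
  | false :: false :: z, N => parse1Spec z (N + 1)
  | false :: true :: z, N => (N, z)

/-- The register file after parsing, from the outputs of the two parsers. [folklore] -/
def parsed (N : ℕ) (rest : List Bool) (za za2 zq zk zct zo : List Bool) : Complexity.Regs Rg :=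
  mk [] (Complexity.ones N) (Complexity.ones N) (Complexity.ones N) (parse2Spec rest [] 0).1 (parse2Spec rest [] 0).2.2.reverse (parse2Spec rest [] 0).2.2
    (Complexity.ones (parse2Spec rest [] 0).2.2.length) za za2 [] zq zk zct (Complexity.ones (parse2Spec rest [] 0).2.1) zo

/-- Semantics of `unit3` (cost `3`). [folklore] -/
theorem runs_unit3 (zi : List Bool) (N : ℕ) (zy zr2 zr1 zcn za za2 zt zq zk zct zl zo : List Bool) :
    Runs unit3 (mk zi (Complexity.ones N) (Complexity.ones N) (Complexity.ones N) zy zr2 zr1 zcn za za2 zt zq zk zct zl zo)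
      (mk zi (Complexity.ones (N + 1)) (Complexity.ones (N + 1)) (Complexity.ones (N + 1)) zy zr2 zr1 zcn za za2 zt zq zk zct zl zo) (1 + 1 + 1) := by
  simpa [unit3, ones_succ] using runs_push3 .n0 .nb .nc true true true
    (mk zi (Complexity.ones N) (Complexity.ones N) (Complexity.ones N) zy zr2 zr1 zcn za za2 zt zq zk zct zl zo)

/-- **Semantics of `parse1`** (cost `≤ 8|z| + 3`). [folklore] -/
theorem runs_parse1 : ∀ (z : List Bool) (N : ℕ) (za za2 zq zk zct zo : List Bool),
    Runs parse1 (mk z (Complexity.ones N) (Complexity.ones N) (Complexity.ones N) [] [] [] [] za za2 [] zq zk zct [] zo)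
      (parsed (parse1Spec z N).1 (parse1Spec z N).2 za za2 zq zk zct zo) (8 * z.length + 3)
  | [], N, za, za2, zq, zk, zct, zo => by
    have h : Runs parse1 (mk [] (Complexity.ones N) (Complexity.ones N) (Complexity.ones N) [] [] [] [] za za2 [] zq zk zct [] zo)
        (mk [] (Complexity.ones N) (Complexity.ones N) (Complexity.ones N) [] [] [] [] za za2 [] zq zk zct [] zo) 1 := Runs.loop_nil (k := Rg.inp) _ _ rfl
    simpa [parse1Spec, parsed, parse2Spec] using h.mono (show 1 ≤ 3 by norm_num)
  | [a], N, za, za2, zq, zk, zct, zo => by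
    have hrest : Runs parse1 (mk [] (Complexity.ones N) (Complexity.ones N) (Complexity.ones N) [] [] [] [] za za2 [] zq zk zct [] zo)
        (mk [] (Complexity.ones N) (Complexity.ones N) (Complexity.ones N) [] [] [] [] za za2 [] zq zk zct [] zo) 1 := Runs.loop_nil _ _ rfl
    simp only [parse1Spec, parsed, parse2Spec, List.reverse_nil, List.length_nil]
    refine Runs.mono ?_ (show (0 + 2) + 2 + 1 ≤ 8 * [a].length + 3 by simp)
    cases a
    · exact Runs.loop_false' (w := []) rfl (update_inp ..) (Runs.pop_nil _ _ rfl (Runs.skip _)) hrest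
    · exact Runs.loop_true' (w := []) rfl (update_inp ..) (Runs.pop_nil _ _ rfl (Runs.skip _)) hrest
  | true :: true :: z, N, za, za2, zq, zk, zct, zo => by
    have ih := runs_parse1 z (N + 1) za za2 zq zk zct zo
    simp only [parse1Spec]
    refine Runs.mono ?_ (show (1 + 1 + 1 + 2) + 2 + (8 * z.length + 3) ≤ 8 * (true :: true :: z).length + 3 by
      simp; omega)
    exact Runs.loop_true' rfl (update_inp ..) (Runs.pop_true' _ _ rfl (update_inp ..) (runs_unit3 ..)) ih
  | true :: false :: z, N, za, za2, zq, zk, zct, zo => by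
    have ih := runs_parse1 z N za za2 zq zk zct zo
    simp only [parse1Spec]
    refine Runs.mono ?_ (show (0 + 2) + 2 + (8 * z.length + 3) ≤ 8 * (true :: false :: z).length + 3 by
      simp; omega)
    exact Runs.loop_true' rfl (update_inp ..) (Runs.pop_false' _ _ rfl (update_inp ..) (Runs.skip _)) ih
  | false :: false :: z, N, za, za2, zq, zk, zct, zo => by
    have ih := runs_parse1 z (N + 1) za za2 zq zk zct zo
    simp only [parse1Spec]
    refine Runs.mono ?_ (show (1 + 1 + 1 + 2) + 2 + (8 * z.length + 3) ≤ 8 * (false :: false :: z).length + 3 by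
      simp; omega)
    exact Runs.loop_false' rfl (update_inp ..) (Runs.pop_false' _ _ rfl (update_inp ..) (runs_unit3 ..)) ih
  | false :: true :: z, N, za, za2, zq, zk, zct, zo => by
    have hp2 := runs_parse2 z (Complexity.ones N) (Complexity.ones N) (Complexity.ones N) [] 0 za za2 zq zk zct zo
    have hrest : Runs parse1 (parsed N z za za2 zq zk zct zo) (parsed N z za za2 zq zk zct zo) 1 :=
      Runs.loop_nil _ _ rfl
    simp only [parse1Spec]
    refine Runs.mono ?_ (show ((8 * z.length + 3) + 2) + 2 + 1 ≤ 8 * (false :: true :: z).length + 3 by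
      simp; omega)
    exact Runs.loop_false' rfl (update_inp ..) (Runs.pop_true' _ _ rfl (update_inp ..) hp2) hrest

/-- `parse1` on a pair. [folklore] -/
theorem parse1Spec_boolPair : ∀ (a w : List Bool) (N : ℕ), parse1Spec (Complexity.boolPair a w) N = (N + a.length, w)
  | [], w, N => by simp [Complexity.boolPair, parse1Spec]
  | b :: a, w, N => by
    have hcons : Complexity.boolPair (b :: a) w = b :: b :: Complexity.boolPair a w := by simp [Complexity.boolPair]
    rw [hcons]
    cases b
    · rw [parse1Spec, parse1Spec_boolPair a w]; simp only [List.length_cons, Prod.mk.injEq, and_true]; omega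
    · rw [parse1Spec, parse1Spec_boolPair a w]; simp only [List.length_cons, Prod.mk.injEq, and_true]; omega

/-- Sizes after `parse1`. [folklore] -/
theorem parse1Spec_le : ∀ (z : List Bool) (N : ℕ),
    (parse1Spec z N).1 + (parse1Spec z N).2.length ≤ N + z.length
  | [], N => by simp [parse1Spec]
  | [_], N => by simp [parse1Spec]
  | true :: true :: z, N => by have := parse1Spec_le z (N + 1); simp [parse1Spec] at this ⊢; omega
  | true :: false :: z, N => by have := parse1Spec_le z N; simp [parse1Spec] at this ⊢; omega
  | false :: false :: z, N => by have := parse1Spec_le z (N + 1); simp [parse1Spec] at this ⊢; omega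
  | false :: true :: z, N => by simp [parse1Spec]; omega

/-! #### Taking the padding `r ↾ t` and extracting the coins `ρ` -/

/-- Body of the take loop: move one bit of `r1` to `tmp`, counting it in `lx`. [folklore] -/
def takeBody : Complexity.Com Rg := pop .r1 (push .tmp true ;; push .lx true) (push .tmp false ;; push .lx true) skip

/-- The take loop, driven by the unary counter `q0 = 1ᵗ`. [folklore] -/
def takeLoop : Complexity.Com Rg := loop .q0 takeBody takeBody

/-- **Semantics of the take loop** (cost `≤ 6t + 1`): `tmp := reverse (r1 ↾ t) ++ tmp`,
`r1 := r1 ⇂ t`, `lx` gains `min t |r1|` units. [folklore] -/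
theorem runs_takeLoop : ∀ (t : ℕ) (w : List Bool) (zi zn znb znc zy zr2 zcn za za2 zt : List Bool) (L : ℕ)
    (zk zct zo : List Bool),
    Runs takeLoop (mk zi zn znb znc zy zr2 w zcn za za2 zt (Complexity.ones t) zk zct (Complexity.ones L) zo)
      (mk zi zn znb znc zy zr2 (w.drop t) zcn za za2 ((w.take t).reverse ++ zt) [] zk zct (Complexity.ones (min t w.length + L)) zo)
      (6 * t + 1)
  | 0, w, zi, zn, znb, znc, zy, zr2, zcn, za, za2, zt, L, zk, zct, zo => by
    have h : Runs takeLoop (mk zi zn znb znc zy zr2 w zcn za za2 zt [] zk zct (Complexity.ones L) zo)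
        (mk zi zn znb znc zy zr2 w zcn za za2 zt [] zk zct (Complexity.ones L) zo) 1 := Runs.loop_nil (k := Rg.q0) _ _ rfl
    simpa using h
  | t + 1, [], zi, zn, znb, znc, zy, zr2, zcn, za, za2, zt, L, zk, zct, zo => by
    have hbody : Runs takeBody (mk zi zn znb znc zy zr2 [] zcn za za2 zt (Complexity.ones t) zk zct (Complexity.ones L) zo)
        (mk zi zn znb znc zy zr2 [] zcn za za2 zt (Complexity.ones t) zk zct (Complexity.ones L) zo) (1 + 1 + 2) :=
      (Runs.pop_nil _ _ rfl (Runs.skip _)).mono (by norm_num)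
    have ih := runs_takeLoop t [] zi zn znb znc zy zr2 zcn za za2 zt L zk zct zo
    simp only [List.drop_nil, List.take_nil, List.reverse_nil, List.nil_append, List.length_nil,
      Nat.min_zero, Nat.zero_add] at ih ⊢
    rw [show 6 * (t + 1) + 1 = (1 + 1 + 2) + 2 + (6 * t + 1) by ring]
    exact Runs.loop_true' (R := mk zi zn znb znc zy zr2 [] zcn za za2 zt (Complexity.ones (t + 1)) zk zct (Complexity.ones L) zo) rfl
      (update_q0 ..) hbody ih
  | t + 1, b :: w, zi, zn, znb, znc, zy, zr2, zcn, za, za2, zt, L, zk, zct, zo => by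
    have h2 : Runs (push .tmp b ;; push .lx true) (mk zi zn znb znc zy zr2 w zcn za za2 zt (Complexity.ones t) zk zct (Complexity.ones L) zo)
        (mk zi zn znb znc zy zr2 w zcn za za2 (b :: zt) (Complexity.ones t) zk zct (Complexity.ones (L + 1)) zo) (1 + 1) := by
      simpa [ones_succ] using runs_push2 .tmp .lx b true (mk zi zn znb znc zy zr2 w zcn za za2 zt (Complexity.ones t) zk zct (Complexity.ones L) zo)
    have hbody : Runs takeBody (mk zi zn znb znc zy zr2 (b :: w) zcn za za2 zt (Complexity.ones t) zk zct (Complexity.ones L) zo)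
        (mk zi zn znb znc zy zr2 w zcn za za2 (b :: zt) (Complexity.ones t) zk zct (Complexity.ones (L + 1)) zo) (1 + 1 + 2) := by
      cases b
      · exact Runs.pop_false' _ _ rfl (update_r1 ..) h2
      · exact Runs.pop_true' _ _ rfl (update_r1 ..) h2
    have ih := runs_takeLoop t w zi zn znb znc zy zr2 zcn za za2 (b :: zt) (L + 1) zk zct zo
    rw [show min t w.length + (L + 1) = min (t + 1) (b :: w).length + L by simp; omega,
      show (w.take t).reverse ++ b :: zt = ((b :: w).take (t + 1)).reverse ++ zt by simp] at ih
    rw [show 6 * (t + 1) + 1 = (1 + 1 + 2) + 2 + (6 * t + 1) by ring]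
    exact Runs.loop_true' (R := mk zi zn znb znc zy zr2 (b :: w) zcn za za2 zt (Complexity.ones (t + 1)) zk zct (Complexity.ones L) zo) rfl
      (update_q0 ..) hbody ih

/-- Body of the extraction loop: move one bit of `r2` (a coin, last ones first) to the output. [folklore] -/
def outBody : Complexity.Com Rg := pop .r2 (push .out true) (push .out false) skip

/-- The extraction loop, driven by the unary counter `kk = 1^κ`. [folklore] -/
def extract : Complexity.Com Rg := loop .kk outBody outBody

/-- **Semantics of the extraction loop** (cost `≤ 5κ + 1`): `out := reverse (r2 ↾ κ) ++ out`,
`r2 := r2 ⇂ κ`. [folklore] -/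
theorem runs_extract : ∀ (κ : ℕ) (w : List Bool) (zi zn znb znc zy zr1 zcn za za2 zt zq zct zl zo : List Bool),
    Runs extract (mk zi zn znb znc zy w zr1 zcn za za2 zt zq (Complexity.ones κ) zct zl zo)
      (mk zi zn znb znc zy (w.drop κ) zr1 zcn za za2 zt zq [] zct zl ((w.take κ).reverse ++ zo)) (5 * κ + 1)
  | 0, w, zi, zn, znb, znc, zy, zr1, zcn, za, za2, zt, zq, zct, zl, zo => by
    have h : Runs extract (mk zi zn znb znc zy w zr1 zcn za za2 zt zq [] zct zl zo)
        (mk zi zn znb znc zy w zr1 zcn za za2 zt zq [] zct zl zo) 1 := Runs.loop_nil (k := Rg.kk) _ _ rfl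
    simpa using h
  | κ + 1, [], zi, zn, znb, znc, zy, zr1, zcn, za, za2, zt, zq, zct, zl, zo => by
    have hbody : Runs outBody (mk zi zn znb znc zy [] zr1 zcn za za2 zt zq (Complexity.ones κ) zct zl zo)
        (mk zi zn znb znc zy [] zr1 zcn za za2 zt zq (Complexity.ones κ) zct zl zo) (1 + 2) :=
      (Runs.pop_nil _ _ rfl (Runs.skip _)).mono (by norm_num)
    have ih := runs_extract κ [] zi zn znb znc zy zr1 zcn za za2 zt zq zct zl zo
    simp only [List.drop_nil, List.take_nil, List.reverse_nil, List.nil_append] at ih ⊢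
    rw [show 5 * (κ + 1) + 1 = (1 + 2) + 2 + (5 * κ + 1) by ring]
    exact Runs.loop_true' (R := mk zi zn znb znc zy [] zr1 zcn za za2 zt zq (Complexity.ones (κ + 1)) zct zl zo) rfl
      (update_kk ..) hbody ih
  | κ + 1, b :: w, zi, zn, znb, znc, zy, zr1, zcn, za, za2, zt, zq, zct, zl, zo => by
    have hbody : Runs outBody (mk zi zn znb znc zy (b :: w) zr1 zcn za za2 zt zq (Complexity.ones κ) zct zl zo)
        (mk zi zn znb znc zy w zr1 zcn za za2 zt zq (Complexity.ones κ) zct zl (b :: zo)) (1 + 2) := by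
      cases b
      · exact Runs.pop_false' _ _ rfl (update_r2 ..) (Runs.push' (update_out ..))
      · exact Runs.pop_true' _ _ rfl (update_r2 ..) (Runs.push' (update_out ..))
    have ih := runs_extract κ w zi zn znb znc zy zr1 zcn za za2 zt zq zct zl (b :: zo)
    rw [show (w.take κ).reverse ++ b :: zo = ((b :: w).take (κ + 1)).reverse ++ zo by simp] at ih
    rw [show 5 * (κ + 1) + 1 = (1 + 2) + 2 + (5 * κ + 1) by ring]
    exact Runs.loop_true' (R := mk zi zn znb znc zy (b :: w) zr1 zcn za za2 zt zq (Complexity.ones (κ + 1)) zct zl zo) rfl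
      (update_kk ..) hbody ih

/-! #### Unary Horner evaluation of `Q(n)`, `Q(n+1)`, `K(n)` (generic `Com.hornerProg` of `StackUnary.lean`) -/

/-- **Evaluation program** on this register bank: `Com.hornerProg .n0 .acc .acc2 .tmp (coeffsHL Q)`
turns `acc = []` into `acc = 1^{Q(n)}` in `(deg Q + 1) · (Q(n+1) · (10 n + 5) + 2)` steps
(`Com.runs_evalPoly`). [folklore] -/
theorem runs_evalQ (Q : Polynomial ℕ) (n : ℕ) (zi znb znc zy zr2 zr1 zcn zq zk zct zl zo : List Bool) :
    Runs (hornerProg .n0 .acc .acc2 .tmp (coeffsHL Q)) (mk zi (Complexity.ones n) znb znc zy zr2 zr1 zcn [] [] [] zq zk zct zl zo)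
      (mk zi (Complexity.ones n) znb znc zy zr2 zr1 zcn (Complexity.ones (Q.eval n)) [] [] zq zk zct zl zo)
      ((Q.natDegree + 1) * (Q.eval (n + 1) * (10 * n + 5) + 2)) := by
  have := runs_evalPoly (n := Rg.n0) (a := Rg.acc) (a2 := Rg.acc2) (t := Rg.tmp) (by decide) (by decide) (by decide)
    (by decide) (by decide) (by decide) Q n (mk zi (Complexity.ones n) znb znc zy zr2 zr1 zcn [] [] [] zq zk zct zl zo) rfl rfl rfl rfl
  simpa using this

/-! #### Unary division with remainder by repeated countdown -/

/-- Reload the countdown register from `kk` and count one more multiple in `q0`. [folklore] -/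
def reload : Complexity.Com Rg := push .q0 true ;; copy .kk .cnt .tmp .acc2

/-- After the decrement: if the countdown is exhausted, reload; otherwise put the unit back. [folklore] -/
def divTest : Complexity.Com Rg := pop .cnt (push .cnt true) (push .cnt true) reload

/-- Body of the division loop: decrement the countdown and test. [folklore] -/
def divBody : Complexity.Com Rg := pop .cnt divTest divTest skip

/-- The division loop over the unary dividend `cn`. [folklore] -/
def divLoop : Complexity.Com Rg := loop .cn divBody divBody

/-- Division with remainder of `cn` by `kk`: quotient added to `q0`, remainder left in `kk`; by the
conventions of `ℕ`, `m / 0 = 0` and `m % 0 = m` (the `kk = []` branch). [folklore] -/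
def divide : Complexity.Com Rg :=
  pop .kk (push .kk true ;; copy .kk .cnt .tmp .acc2 ;; divLoop ;; subFrom .kk .cnt)
    (push .kk true ;; copy .kk .cnt .tmp .acc2 ;; divLoop ;; subFrom .kk .cnt) (pour .cn .kk)

/-- One step of the countdown arithmetic on `(counter, quotient)`. [folklore] -/
def divStep (k : ℕ) (p : ℕ × ℕ) : ℕ × ℕ :=
  if p.1 = 0 then p else if p.1 = 1 then (k, p.2 + 1) else (p.1 - 1, p.2)

/-- The countdown arithmetic over `m` units. [folklore] -/
def divN (k : ℕ) : ℕ → ℕ × ℕ → ℕ × ℕ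
  | 0, p => p
  | m + 1, p => divN k m (divStep k p)

/-- Semantics of `reload` (cost `10k + 4`). [folklore] -/
theorem runs_reload (k q : ℕ) (zi zn znb znc zy zr2 zr1 zcn za zl zo : List Bool) (c : ℕ) :
    Runs reload (mk zi zn znb znc zy zr2 zr1 zcn za [] [] (Complexity.ones q) (Complexity.ones k) (Complexity.ones c) zl zo)
      (mk zi zn znb znc zy zr2 zr1 zcn za [] [] (Complexity.ones (q + 1)) (Complexity.ones k) (Complexity.ones (k + c)) zl zo) (1 + (10 * k + 3)) := by
  refine Runs.seq (Runs.push' (update_q0 ..)) ?_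
  have := runs_copy (a := Rg.kk) (b := Rg.cnt) (t := Rg.tmp) (u := Rg.acc2) (by decide) (by decide) (by decide)
    (by decide) (by decide) (by decide) (mk zi zn znb znc zy zr2 zr1 zcn za [] [] (true :: Complexity.ones q) (Complexity.ones k) (Complexity.ones c) zl zo)
    rfl rfl
  simpa [ones_succ, ones_append] using this

/-- **Semantics of the division body** on a positive counter (cost `≤ 10k + 8`). [folklore] -/
theorem runs_divBody (k c q : ℕ) (hc : 1 ≤ c) (zi zn znb znc zy zr2 zr1 zcn za zl zo : List Bool) :
    Runs divBody (mk zi zn znb znc zy zr2 zr1 zcn za [] [] (Complexity.ones q) (Complexity.ones k) (Complexity.ones c) zl zo)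
      (mk zi zn znb znc zy zr2 zr1 zcn za [] [] (Complexity.ones (divStep k (c, q)).2) (Complexity.ones k) (Complexity.ones (divStep k (c, q)).1) zl zo)
      (10 * k + 8) := by
  obtain ⟨c, rfl⟩ : ∃ c', c = c' + 1 := ⟨c - 1, by omega⟩
  unfold divBody divTest
  refine Runs.mono (Runs.pop_true' (R := mk zi zn znb znc zy zr2 zr1 zcn za [] [] (Complexity.ones q) (Complexity.ones k) (Complexity.ones (c + 1)) zl zo)
    _ _ rfl (update_cnt ..) ?_) (show (10 * k + 4) + 2 + 2 ≤ 10 * k + 8 by omega)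
  rcases c with _ | c
  · -- counter exhausted: reload
    have h := runs_reload k q zi zn znb znc zy zr2 zr1 zcn za zl zo 0
    simp only [Nat.add_zero] at h
    simpa [divStep] using Runs.pop_nil _ _ rfl (h.mono (by omega))
  · -- put the unit back
    have h : Runs (push .cnt true) (mk zi zn znb znc zy zr2 zr1 zcn za [] [] (Complexity.ones q) (Complexity.ones k) (Complexity.ones c) zl zo)
        (mk zi zn znb znc zy zr2 zr1 zcn za [] [] (Complexity.ones q) (Complexity.ones k) (Complexity.ones (c + 1)) zl zo) 1 := Runs.push' (update_cnt ..)
    simpa [divStep, ones_succ] using Runs.pop_true' (R := mk zi zn znb znc zy zr2 zr1 zcn za [] [] (Complexity.ones q) (Complexity.ones k) (Complexity.ones (c + 1)) zl zo)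
      _ _ rfl (update_cnt ..) (h.mono (show 1 ≤ 10 * k + 4 by omega))

/-- The countdown stays positive and bounded. [folklore] -/
theorem divStep_bounds {k : ℕ} {p : ℕ × ℕ} (h1 : 1 ≤ p.1) (h2 : p.1 ≤ k) :
    1 ≤ (divStep k p).1 ∧ (divStep k p).1 ≤ k := by
  unfold divStep
  split_ifs with ha hb
  · exact absurd ha (by omega)
  · exact ⟨show 1 ≤ k by omega, le_rfl⟩
  · exact ⟨show 1 ≤ p.1 - 1 by omega, show p.1 - 1 ≤ k by omega⟩

/-- **Semantics of the division loop** (cost `≤ m (10k + 10) + 1`). [folklore] -/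
theorem runs_divLoop (k : ℕ) : ∀ (m c q : ℕ), 1 ≤ c → c ≤ k →
    ∀ (zi zn znb znc zy zr2 zr1 za zl zo : List Bool),
    Runs divLoop (mk zi zn znb znc zy zr2 zr1 (Complexity.ones m) za [] [] (Complexity.ones q) (Complexity.ones k) (Complexity.ones c) zl zo)
      (mk zi zn znb znc zy zr2 zr1 [] za [] [] (Complexity.ones (divN k m (c, q)).2) (Complexity.ones k) (Complexity.ones (divN k m (c, q)).1) zl zo)
      (m * (10 * k + 10) + 1)
  | 0, c, q, _, _, zi, zn, znb, znc, zy, zr2, zr1, za, zl, zo => by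
    have h : Runs divLoop (mk zi zn znb znc zy zr2 zr1 [] za [] [] (Complexity.ones q) (Complexity.ones k) (Complexity.ones c) zl zo)
        (mk zi zn znb znc zy zr2 zr1 [] za [] [] (Complexity.ones q) (Complexity.ones k) (Complexity.ones c) zl zo) 1 := Runs.loop_nil (k := Rg.cn) _ _ rfl
    simpa [divN] using h
  | m + 1, c, q, hc, hck, zi, zn, znb, znc, zy, zr2, zr1, za, zl, zo => by
    have hbody := runs_divBody k c q hc zi zn znb znc zy zr2 zr1 (Complexity.ones m) za zl zo
    obtain ⟨hc', hck'⟩ := divStep_bounds (p := (c, q)) hc hck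
    have ih := runs_divLoop k m (divStep k (c, q)).1 (divStep k (c, q)).2 hc' hck' zi zn znb znc zy zr2 zr1 za zl zo
    simp only [divN]
    rw [show (m + 1) * (10 * k + 10) + 1 = (10 * k + 8) + 2 + (m * (10 * k + 10) + 1) by ring]
    exact Runs.loop_true' (R := mk zi zn znb znc zy zr2 zr1 (Complexity.ones (m + 1)) za [] [] (Complexity.ones q) (Complexity.ones k) (Complexity.ones c) zl zo) rfl
      (update_cn ..) hbody ih

/-- **Arithmetic of the countdown**: from counter `c ∈ [1, k]` (i.e. `k - c` units into the current
round) over `m` units, the quotient gains `(m + (k - c)) / k` and the counter ends at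
`k - (m + (k - c)) % k`. [folklore] -/
theorem divN_eq (k : ℕ) : ∀ (m c q : ℕ), 1 ≤ c → c ≤ k →
    divN k m (c, q) = (k - (m + (k - c)) % k, q + (m + (k - c)) / k)
  | 0, c, q, hc, hck => by
    simp only [divN, Nat.zero_add]
    rw [Nat.mod_eq_of_lt (by omega), Nat.div_eq_of_lt (by omega)]
    ext
    · show c = k - (k - c); omega
    · show q = q + 0; omega
  | m + 1, c, q, hc, hck => by
    simp only [divN]
    by_cases h1 : c = 1
    · subst h1
      have hs : divStep k (1, q) = (k, q + 1) := by simp [divStep]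
      rw [hs, divN_eq k m k (q + 1) (by omega) le_rfl, Nat.sub_self, Nat.add_zero,
        show m + 1 + (k - 1) = m + k by omega, Nat.add_mod_right, Nat.add_div_right _ (by omega)]
      ext <;> simp; omega
    · have hs : divStep k (c, q) = (c - 1, q) := by
        simp [divStep, h1]; omega
      rw [hs, divN_eq k m (c - 1) q (by omega) (by omega), show m + (k - (c - 1)) = m + 1 + (k - c) by omega]

/-- **Semantics of `divide`** (cost `≤ (m + 2)(10k + 10)`): `q0` gains `m / k`, `kk := 1^{m % k}`,
`cn` and `cnt` are emptied (with `m / 0 = 0`, `m % 0 = m`). [folklore] -/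
theorem runs_divide (m k q : ℕ) (zi zn znb znc zy zr2 zr1 za zl zo : List Bool) :
    Runs divide (mk zi zn znb znc zy zr2 zr1 (Complexity.ones m) za [] [] (Complexity.ones q) (Complexity.ones k) [] zl zo)
      (mk zi zn znb znc zy zr2 zr1 [] za [] [] (Complexity.ones (q + m / k)) (Complexity.ones (m % k)) [] zl zo) ((m + 2) * (10 * k + 10)) := by
  unfold divide
  rcases k with _ | k
  · -- division by zero
    have h : Runs (pour .cn .kk) (mk zi zn znb znc zy zr2 zr1 (Complexity.ones m) za [] [] (Complexity.ones q) [] [] zl zo)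
        (mk zi zn znb znc zy zr2 zr1 [] za [] [] (Complexity.ones q) (Complexity.ones m) [] zl zo) (3 * m + 1) := by
      have := runs_pour (a := Rg.cn) (b := Rg.kk) (by decide) (mk zi zn znb znc zy zr2 zr1 (Complexity.ones m) za [] [] (Complexity.ones q) [] [] zl zo)
      simpa using this
    simpa using (Runs.pop_nil _ _ rfl h).mono (show 3 * m + 1 + 2 ≤ (m + 2) * (10 * 0 + 10) by ring_nf; omega)
  · have h1 : Runs (push .kk true) (mk zi zn znb znc zy zr2 zr1 (Complexity.ones m) za [] [] (Complexity.ones q) (Complexity.ones k) [] zl zo)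
        (mk zi zn znb znc zy zr2 zr1 (Complexity.ones m) za [] [] (Complexity.ones q) (Complexity.ones (k + 1)) [] zl zo) 1 := Runs.push' (update_kk ..)
    have h2 : Runs (copy .kk .cnt .tmp .acc2) (mk zi zn znb znc zy zr2 zr1 (Complexity.ones m) za [] [] (Complexity.ones q) (Complexity.ones (k + 1)) [] zl zo)
        (mk zi zn znb znc zy zr2 zr1 (Complexity.ones m) za [] [] (Complexity.ones q) (Complexity.ones (k + 1)) (Complexity.ones (k + 1)) zl zo) (10 * (k + 1) + 3) := by
      have := runs_copy (a := Rg.kk) (b := Rg.cnt) (t := Rg.tmp) (u := Rg.acc2) (by decide) (by decide) (by decide)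
        (by decide) (by decide) (by decide) (mk zi zn znb znc zy zr2 zr1 (Complexity.ones m) za [] [] (Complexity.ones q) (Complexity.ones (k + 1)) [] zl zo)
        rfl rfl
      simpa using this
    have h3 := runs_divLoop (k + 1) m (k + 1) q (by omega) le_rfl zi zn znb znc zy zr2 zr1 za zl zo
    rw [divN_eq (k + 1) m (k + 1) q (by omega) le_rfl, Nat.sub_self, Nat.add_zero] at h3
    set c' := k + 1 - m % (k + 1) with hc'
    have h4 : Runs (subFrom .kk .cnt) (mk zi zn znb znc zy zr2 zr1 [] za [] [] (Complexity.ones (q + m / (k + 1))) (Complexity.ones (k + 1)) (Complexity.ones c') zl zo)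
        (mk zi zn znb znc zy zr2 zr1 [] za [] [] (Complexity.ones (q + m / (k + 1))) (Complexity.ones (m % (k + 1))) [] zl zo) (4 * c' + 1) := by
      have := runs_subFrom (x := Rg.kk) (y := Rg.cnt) (by decide) (Complexity.ones c')
        (mk zi zn znb znc zy zr2 zr1 [] za [] [] (Complexity.ones (q + m / (k + 1))) (Complexity.ones (k + 1)) (Complexity.ones c') zl zo) rfl
      have hmod := Nat.mod_lt m (show 0 < k + 1 by omega)
      have hlen : (Complexity.ones c').length = c' := by simp
      rw [hlen] at this
      simpa [Complexity.ones, List.drop_replicate, show k + 1 - c' = m % (k + 1) by omega] using this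
    refine Runs.mono (Runs.pop_true' _ _ rfl (update_kk ..) (h1.seq (h2.seq (h3.seq h4)))) ?_
    have : c' ≤ k + 1 := by omega
    nlinarith

/-! #### The logarithm `3⌊log₂ n⌋` by repeated halving -/

/-- Body of the halving loop: drop one unit, keep one. [folklore] -/
def halveBody : Complexity.Com Rg := pop .nc (push .acc true) (push .acc true) skip

/-- The halving loop: `acc` gains `⌊nc / 2⌋` units, `nc` is emptied. [folklore] -/
def halve : Complexity.Com Rg := loop .nc halveBody halveBody

/-- One halving step with its bookkeeping: for `nc ≥ 2`, `nc := ⌊nc/2⌋` and `lx` loses `3` units;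
for `nc ≤ 1`, `nc := 0`. [folklore] -/
def logBody : Complexity.Com Rg :=
  pop .nc (pop .nc (push .acc true ;; halve ;; pour .acc .nc ;; popK .lx 3)
      (push .acc true ;; halve ;; pour .acc .nc ;; popK .lx 3) skip)
    (pop .nc (push .acc true ;; halve ;; pour .acc .nc ;; popK .lx 3)
      (push .acc true ;; halve ;; pour .acc .nc ;; popK .lx 3) skip) skip

/-- The logarithm loop, driven by the fuel `nb = 1ⁿ` (`n ≥ ⌊log₂ n⌋` halvings suffice). [folklore] -/
def logLoop : Complexity.Com Rg := loop .nb logBody logBody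

/-- The arithmetic of one halving step on `(value, threshold units)`. [folklore] -/
def logStepN (p : ℕ × ℕ) : ℕ × ℕ := (p.1 / 2, if 2 ≤ p.1 then p.2 - 3 else p.2)

/-- The arithmetic of the logarithm loop. [folklore] -/
def logN : ℕ → ℕ × ℕ → ℕ × ℕ
  | 0, p => p
  | f + 1, p => logN f (logStepN p)

/-- **Semantics of the halving loop** (cost `≤ 5v + 1`). [folklore] -/
theorem runs_halve : ∀ (v a : ℕ) (zi zn znb zy zr2 zr1 zcn za2 zt zq zk zct zl zo : List Bool),
    Runs halve (mk zi zn znb (Complexity.ones v) zy zr2 zr1 zcn (Complexity.ones a) za2 zt zq zk zct zl zo)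
      (mk zi zn znb [] zy zr2 zr1 zcn (Complexity.ones (a + v / 2)) za2 zt zq zk zct zl zo) (5 * v + 1)
  | 0, a, zi, zn, znb, zy, zr2, zr1, zcn, za2, zt, zq, zk, zct, zl, zo => by
    have h : Runs halve (mk zi zn znb [] zy zr2 zr1 zcn (Complexity.ones a) za2 zt zq zk zct zl zo)
        (mk zi zn znb [] zy zr2 zr1 zcn (Complexity.ones a) za2 zt zq zk zct zl zo) 1 := Runs.loop_nil (k := Rg.nc) _ _ rfl
    simpa using h
  | 1, a, zi, zn, znb, zy, zr2, zr1, zcn, za2, zt, zq, zk, zct, zl, zo => by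
    have hbody : Runs halveBody (mk zi zn znb [] zy zr2 zr1 zcn (Complexity.ones a) za2 zt zq zk zct zl zo)
        (mk zi zn znb [] zy zr2 zr1 zcn (Complexity.ones a) za2 zt zq zk zct zl zo) 2 := Runs.pop_nil _ _ rfl (Runs.skip _)
    have hrest : Runs halve (mk zi zn znb [] zy zr2 zr1 zcn (Complexity.ones a) za2 zt zq zk zct zl zo)
        (mk zi zn znb [] zy zr2 zr1 zcn (Complexity.ones a) za2 zt zq zk zct zl zo) 1 := Runs.loop_nil (k := Rg.nc) _ _ rfl
    have h : Runs halve (mk zi zn znb (Complexity.ones 1) zy zr2 zr1 zcn (Complexity.ones a) za2 zt zq zk zct zl zo)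
        (mk zi zn znb [] zy zr2 zr1 zcn (Complexity.ones a) za2 zt zq zk zct zl zo) (2 + 2 + 1) :=
      Runs.loop_true' (R := mk zi zn znb (Complexity.ones 1) zy zr2 zr1 zcn (Complexity.ones a) za2 zt zq zk zct zl zo) rfl
        (update_nc ..) hbody hrest
    simpa using h.mono (show 2 + 2 + 1 ≤ 5 * 1 + 1 by norm_num)
  | v + 2, a, zi, zn, znb, zy, zr2, zr1, zcn, za2, zt, zq, zk, zct, zl, zo => by
    have hbody : Runs halveBody (mk zi zn znb (Complexity.ones (v + 1)) zy zr2 zr1 zcn (Complexity.ones a) za2 zt zq zk zct zl zo)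
        (mk zi zn znb (Complexity.ones v) zy zr2 zr1 zcn (Complexity.ones (a + 1)) za2 zt zq zk zct zl zo) (1 + 2) :=
      Runs.pop_true' _ _ rfl (update_nc ..) (Runs.push' (update_acc ..))
    have ih := runs_halve v (a + 1) zi zn znb zy zr2 zr1 zcn za2 zt zq zk zct zl zo
    rw [show a + 1 + v / 2 = a + (v + 2) / 2 by omega] at ih
    exact (Runs.loop_true' (R := mk zi zn znb (Complexity.ones (v + 2)) zy zr2 zr1 zcn (Complexity.ones a) za2 zt zq zk zct zl zo) rfl
      (update_nc ..) hbody ih).mono (by omega)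

/-- **Semantics of one logarithm step** (cost `≤ 7v + 16`). [folklore] -/
theorem runs_logBody (v : ℕ) (zi zn znb zy zr2 zr1 zcn za2 zt zq zk zct : List Bool) (L : ℕ) (zo : List Bool) :
    Runs logBody (mk zi zn znb (Complexity.ones v) zy zr2 zr1 zcn [] za2 zt zq zk zct (Complexity.ones L) zo)
      (mk zi zn znb (Complexity.ones (logStepN (v, L)).1) zy zr2 zr1 zcn [] za2 zt zq zk zct (Complexity.ones (logStepN (v, L)).2) zo)
      (7 * v + 16) := by
  unfold logBody
  rcases v with _ | _ | v
  · simpa [logStepN] using (Runs.pop_nil _ _ (rfl : mk zi zn znb (Complexity.ones 0) zy zr2 zr1 zcn [] za2 zt zq zk zct (Complexity.ones L) zo .nc = [])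
      (Runs.skip _)).mono (show 0 + 2 ≤ 7 * 0 + 16 by norm_num)
  · have h : Runs (pop .nc (push .acc true ;; halve ;; pour .acc .nc ;; popK .lx 3)
        (push .acc true ;; halve ;; pour .acc .nc ;; popK .lx 3) skip)
        (mk zi zn znb [] zy zr2 zr1 zcn [] za2 zt zq zk zct (Complexity.ones L) zo)
        (mk zi zn znb [] zy zr2 zr1 zcn [] za2 zt zq zk zct (Complexity.ones L) zo) (0 + 2) := Runs.pop_nil _ _ rfl (Runs.skip _)
    simpa [logStepN] using (Runs.pop_true' (R := mk zi zn znb (Complexity.ones 1) zy zr2 zr1 zcn [] za2 zt zq zk zct (Complexity.ones L) zo)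
      _ _ rfl (update_nc ..) h).mono (show 0 + 2 + 2 ≤ 7 * (0 + 1) + 16 by norm_num)
  · -- `v + 2 ≥ 2`: halve
    have h1 : Runs (push .acc true) (mk zi zn znb (Complexity.ones v) zy zr2 zr1 zcn [] za2 zt zq zk zct (Complexity.ones L) zo)
        (mk zi zn znb (Complexity.ones v) zy zr2 zr1 zcn (Complexity.ones 1) za2 zt zq zk zct (Complexity.ones L) zo) 1 := Runs.push' (update_acc ..)
    have h2 := runs_halve v 1 zi zn znb zy zr2 zr1 zcn za2 zt zq zk zct (Complexity.ones L) zo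
    have h3 : Runs (pour .acc .nc) (mk zi zn znb [] zy zr2 zr1 zcn (Complexity.ones (1 + v / 2)) za2 zt zq zk zct (Complexity.ones L) zo)
        (mk zi zn znb (Complexity.ones (1 + v / 2)) zy zr2 zr1 zcn [] za2 zt zq zk zct (Complexity.ones L) zo) (3 * (1 + v / 2) + 1) := by
      have := runs_pour (a := Rg.acc) (b := Rg.nc) (by decide)
        (mk zi zn znb [] zy zr2 zr1 zcn (Complexity.ones (1 + v / 2)) za2 zt zq zk zct (Complexity.ones L) zo)
      simpa using this
    have h4 : Runs (popK .lx 3) (mk zi zn znb (Complexity.ones (1 + v / 2)) zy zr2 zr1 zcn [] za2 zt zq zk zct (Complexity.ones L) zo)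
        (mk zi zn znb (Complexity.ones (1 + v / 2)) zy zr2 zr1 zcn [] za2 zt zq zk zct (Complexity.ones (L - 3)) zo) (2 * 3) := by
      have := runs_popK .lx 3 (mk zi zn znb (Complexity.ones (1 + v / 2)) zy zr2 zr1 zcn [] za2 zt zq zk zct (Complexity.ones L) zo)
      simpa [Complexity.ones, List.drop_replicate] using this
    have h1234 := h1.seq (h2.seq (h3.seq h4))
    have hstep : logStepN (v + 1 + 1, L) = (1 + v / 2, L - 3) := by
      simp [logStepN]; omega
    rw [hstep]
    refine (Runs.pop_true' (R := mk zi zn znb (Complexity.ones (v + 1 + 1)) zy zr2 zr1 zcn [] za2 zt zq zk zct (Complexity.ones L) zo) _ _ rfl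
      (update_nc ..) (Runs.pop_true' (R := mk zi zn znb (Complexity.ones (v + 1)) zy zr2 zr1 zcn [] za2 zt zq zk zct (Complexity.ones L) zo)
        _ _ rfl (update_nc ..) h1234)).mono ?_
    omega

/-- The value only decreases. [folklore] -/
theorem logStepN_fst_le (p : ℕ × ℕ) : (logStepN p).1 ≤ p.1 := Nat.div_le_self _ _

/-- **Semantics of the logarithm loop** (cost `≤ f (7v + 18) + 1`). [folklore] -/
theorem runs_logLoop : ∀ (f v L : ℕ) (zi zn zy zr2 zr1 zcn za2 zt zq zk zct zo : List Bool),
    Runs logLoop (mk zi zn (Complexity.ones f) (Complexity.ones v) zy zr2 zr1 zcn [] za2 zt zq zk zct (Complexity.ones L) zo)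
      (mk zi zn [] (Complexity.ones (logN f (v, L)).1) zy zr2 zr1 zcn [] za2 zt zq zk zct (Complexity.ones (logN f (v, L)).2) zo)
      (f * (7 * v + 18) + 1)
  | 0, v, L, zi, zn, zy, zr2, zr1, zcn, za2, zt, zq, zk, zct, zo => by
    have h : Runs logLoop (mk zi zn [] (Complexity.ones v) zy zr2 zr1 zcn [] za2 zt zq zk zct (Complexity.ones L) zo)
        (mk zi zn [] (Complexity.ones v) zy zr2 zr1 zcn [] za2 zt zq zk zct (Complexity.ones L) zo) 1 := Runs.loop_nil (k := Rg.nb) _ _ rfl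
    simpa [logN] using h
  | f + 1, v, L, zi, zn, zy, zr2, zr1, zcn, za2, zt, zq, zk, zct, zo => by
    have hbody := runs_logBody v zi zn (Complexity.ones f) zy zr2 zr1 zcn za2 zt zq zk zct L zo
    have ih := runs_logLoop f (logStepN (v, L)).1 (logStepN (v, L)).2 zi zn zy zr2 zr1 zcn za2 zt zq zk zct zo
    have hle : (logStepN (v, L)).1 ≤ v := logStepN_fst_le (v, L)
    simp only [logN]
    refine (Runs.loop_true' (R := mk zi zn (Complexity.ones (f + 1)) (Complexity.ones v) zy zr2 zr1 zcn [] za2 zt zq zk zct (Complexity.ones L) zo) rfl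
      (update_nb ..) hbody ih).mono ?_
    have : f * (7 * (logStepN (v, L)).1 + 18) ≤ f * (7 * v + 18) := Nat.mul_le_mul_left f (by omega)
    rw [show (f + 1) * (7 * v + 18) + 1 = (7 * v + 16) + 2 + (f * (7 * v + 18) + 1) by ring]
    omega

/-- With value `0` nothing happens any more. [folklore] -/
theorem logN_zero : ∀ (f L : ℕ), logN f (0, L) = (0, L)
  | 0, L => rfl
  | f + 1, L => by rw [logN, show logStepN (0, L) = (0, L) by simp [logStepN], logN_zero f L]

/-- **Arithmetic of the logarithm loop**: with fuel `f ≥ v`, the threshold register loses exactly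
`3⌊log₂ v⌋` units (truncated). [folklore] -/
theorem logN_snd : ∀ (f v L : ℕ), v ≤ f → (logN f (v, L)).2 = L - 3 * Nat.log 2 v
  | 0, v, L, h => by
    have hv : v = 0 := by omega
    subst hv; simp [logN]
  | f + 1, v, L, h => by
    rw [logN]
    by_cases hv : 2 ≤ v
    · have hstep : logStepN (v, L) = (v / 2, L - 3) := by simp [logStepN, hv]
      rw [hstep, logN_snd f (v / 2) (L - 3) (by omega), Nat.log_div_base, Nat.sub_sub]
      have := Nat.log_pos (b := 2) (by norm_num) hv
      congr 1
      omega
    · have hstep : logStepN (v, L) = (0, L) := by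
        simp [logStepN, hv]; omega
      rw [hstep, logN_zero, Nat.log_of_lt (by omega)]
      simp

/-! #### Output assembly -/

/-- The separator `01` of `boolPair` (pushed in reverse). [folklore] -/
def sep : Complexity.Com Rg := push .out true ;; push .out false

/-- Assemble the output `⟨1^{thr}, ⟨y ‖ r ↾ t, ρ⟩⟩` bottom-up: the coins `ρ`, a separator, the padded
sample doubled (`tmp` then `yr`), a separator, the threshold doubled. [folklore] -/
def output : Complexity.Com Rg := extract ;; sep ;; pourDbl .tmp .out ;; pourDbl .yr .out ;; sep ;; pourDbl .lx .out

/-- Semantics of `sep` (cost `2`). [folklore] -/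
theorem runs_sep (zi zn znb znc zy zr2 zr1 zcn za za2 zt zq zk zct zl zo : List Bool) :
    Runs sep (mk zi zn znb znc zy zr2 zr1 zcn za za2 zt zq zk zct zl zo)
      (mk zi zn znb znc zy zr2 zr1 zcn za za2 zt zq zk zct zl (false :: true :: zo)) (1 + 1) := by
  simpa [sep] using runs_push2 .out .out true false (mk zi zn znb znc zy zr2 zr1 zcn za za2 zt zq zk zct zl zo)

/-- **Semantics of the output assembly.** [folklore] -/
theorem runs_output (κ : ℕ) (w Y T : List Bool) (thr : ℕ) (zi zn znb znc zr1 zcn za za2 zq zct : List Bool) :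
    Runs output (mk zi zn znb znc Y w zr1 zcn za za2 T zq (Complexity.ones κ) zct (Complexity.ones thr) [])
      (mk zi zn znb znc [] (w.drop κ) zr1 zcn za za2 [] zq [] zct []
        (Complexity.ones (2 * thr) ++ false :: true :: (dbl Y.reverse ++ (dbl T.reverse ++ false :: true :: (w.take κ).reverse))))
      ((5 * κ + 1) + ((1 + 1) + ((4 * T.length + 1) + ((4 * Y.length + 1) + ((1 + 1) + (4 * thr + 1)))))) := by
  have h1 := runs_extract κ w zi zn znb znc Y zr1 zcn za za2 T zq zct (Complexity.ones thr) []
  rw [List.append_nil] at h1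
  have h2 := runs_sep zi zn znb znc Y (w.drop κ) zr1 zcn za za2 T zq [] zct (Complexity.ones thr) (w.take κ).reverse
  have h3 : Runs (pourDbl .tmp .out) (mk zi zn znb znc Y (w.drop κ) zr1 zcn za za2 T zq [] zct (Complexity.ones thr)
      (false :: true :: (w.take κ).reverse))
      (mk zi zn znb znc Y (w.drop κ) zr1 zcn za za2 [] zq [] zct (Complexity.ones thr)
        (dbl T.reverse ++ false :: true :: (w.take κ).reverse)) (4 * T.length + 1) := by
    have := runs_pourDbl (k := Rg.tmp) (o := Rg.out) (by decide) T
      (mk zi zn znb znc Y (w.drop κ) zr1 zcn za za2 T zq [] zct (Complexity.ones thr) (false :: true :: (w.take κ).reverse)) rfl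
    simpa using this
  have h4 : Runs (pourDbl .yr .out) (mk zi zn znb znc Y (w.drop κ) zr1 zcn za za2 [] zq [] zct (Complexity.ones thr)
      (dbl T.reverse ++ false :: true :: (w.take κ).reverse))
      (mk zi zn znb znc [] (w.drop κ) zr1 zcn za za2 [] zq [] zct (Complexity.ones thr)
        (dbl Y.reverse ++ (dbl T.reverse ++ false :: true :: (w.take κ).reverse))) (4 * Y.length + 1) := by
    have := runs_pourDbl (k := Rg.yr) (o := Rg.out) (by decide) Y
      (mk zi zn znb znc Y (w.drop κ) zr1 zcn za za2 [] zq [] zct (Complexity.ones thr)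
        (dbl T.reverse ++ false :: true :: (w.take κ).reverse)) rfl
    simpa using this
  have h5 := runs_sep zi zn znb znc [] (w.drop κ) zr1 zcn za za2 [] zq [] zct (Complexity.ones thr)
    (dbl Y.reverse ++ (dbl T.reverse ++ false :: true :: (w.take κ).reverse))
  have h6 : Runs (pourDbl .lx .out) (mk zi zn znb znc [] (w.drop κ) zr1 zcn za za2 [] zq [] zct (Complexity.ones thr)
      (false :: true :: (dbl Y.reverse ++ (dbl T.reverse ++ false :: true :: (w.take κ).reverse))))
      (mk zi zn znb znc [] (w.drop κ) zr1 zcn za za2 [] zq [] zct []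
        (Complexity.ones (2 * thr) ++ false :: true :: (dbl Y.reverse ++ (dbl T.reverse ++ false :: true :: (w.take κ).reverse))))
      (4 * thr + 1) := by
    have := runs_pourDbl (k := Rg.lx) (o := Rg.out) (by decide) (Complexity.ones thr)
      (mk zi zn znb znc [] (w.drop κ) zr1 zcn za za2 [] zq [] zct (Complexity.ones thr)
        (false :: true :: (dbl Y.reverse ++ (dbl T.reverse ++ false :: true :: (w.take κ).reverse)))) rfl
    rw [List.reverse_replicate, dbl_ones] at this
    simpa using this
  exact h1.seq (h2.seq (h3.seq (h4.seq (h5.seq h6))))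

/-! #### The whole program -/

/-- The post-parsing part of the program (see the module docstring for the phases). [folklore] -/
noncomputable def body (γ : ℕ) (Q K : Polynomial ℕ) : Complexity.Com Rg :=
  hornerProg .n0 .acc .acc2 .tmp (coeffsHL Q) ;; pour .acc .q0 ;; popK .q0 (γ + 1) ;;
  push .n0 true ;; hornerProg .n0 .acc .acc2 .tmp (coeffsHL Q) ;; pop .n0 skip skip skip ;; subFrom .cn .acc ;;
  hornerProg .n0 .acc .acc2 .tmp (coeffsHL K) ;; pour .acc .kk ;; divide ;; subFrom .q0 .n0 ;; takeLoop ;; logLoop ;; output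

/-- **The preprocessing program** of the padding distinguisher. [folklore] -/
noncomputable def prog (γ : ℕ) (Q K : Polynomial ℕ) : Complexity.Com Rg := parse1 ;; body γ Q K

/-- The padding length `t = (Q(n) - γ - 1 + ⌊(C - Q(n+1)) / K(n)⌋) - n` from the values
`q₀ = Q(n)`, `q₁ = Q(n+1)`, `k = K(n)`. [folklore] -/
def tOf (γ n C q0 q1 k : ℕ) : ℕ := (q0 - (γ + 1) + (C - q1) / k) - n

/-- The output of the body from the parsed data `n, Y = reverse y, L = |y|, sr = r` and the values
`q₀, q₁, k`: `⟨1^{thr}, ⟨y ‖ r ↾ t, ρ⟩⟩` with `thr = (|y ‖ r ↾ t|) - 3⌊log₂ n⌋` and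
`ρ =` the last `(C - q₁) mod k` coins. [folklore] -/
def outList (γ n : ℕ) (Y : List Bool) (L : ℕ) (sr : List Bool) (q0 q1 k : ℕ) : List Bool :=
  Complexity.ones (2 * ((min (tOf γ n sr.length q0 q1 k) sr.length + L) - 3 * Nat.log 2 n)) ++ false :: true ::
    (dbl Y.reverse ++ (dbl (sr.take (tOf γ n sr.length q0 q1 k)) ++ false :: true ::
      (sr.reverse.take ((sr.length - q1) % k)).reverse))

/-- The cost of the body (sum of the phase bounds). [folklore] -/
def bodyCost (γ : ℕ) (Q K : Polynomial ℕ) (n C L Ylen q0 q1 k : ℕ) : ℕ :=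
  (Q.natDegree + 1) * (Q.eval (n + 1) * (10 * n + 5) + 2) + (3 * q0 + 1) + 2 * (γ + 1) + 1 +
  (Q.natDegree + 1) * (Q.eval (n + 1 + 1) * (10 * (n + 1) + 5) + 2) + 2 + (4 * q1 + 1) +
  (K.natDegree + 1) * (K.eval (n + 1) * (10 * n + 5) + 2) + (3 * k + 1) + ((C - q1) + 2) * (10 * k + 10) +
  (4 * n + 1) + (6 * tOf γ n C q0 q1 k + 1) + (n * (7 * n + 18) + 1) + (5 * ((C - q1) % k) + 1) + (1 + 1) +
  (4 * min (tOf γ n C q0 q1 k) C + 1) + (4 * Ylen + 1) + (1 + 1) +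
  (4 * ((min (tOf γ n C q0 q1 k) C + L) - 3 * Nat.log 2 n) + 1)

/-- **Semantics of the body** from the parsed register file. [folklore] -/
theorem runs_body (γ : ℕ) (Q K : Polynomial ℕ) (n : ℕ) (Y : List Bool) (L : ℕ) (sr : List Bool)
    (q0 q1 k : ℕ) (hq0 : Q.eval n = q0) (hq1 : Q.eval (n + 1) = q1) (hk : K.eval n = k) :
    ∃ R', Runs (body γ Q K) (mk [] (Complexity.ones n) (Complexity.ones n) (Complexity.ones n) Y sr.reverse sr (Complexity.ones sr.length) [] [] [] [] [] [] (Complexity.ones L) []) R'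
        (bodyCost γ Q K n sr.length L Y.length q0 q1 k) ∧
      R' .out = outList γ n Y L sr q0 q1 k := by
  set C := sr.length with hC
  set m := C - q1 with hm
  set t := tOf γ n C q0 q1 k with ht
  set L' := min t C + L with hL'
  set thr := L' - 3 * Nat.log 2 n with hthr
  -- 1. `acc := Q(n)`
  have h1 := runs_evalQ Q n [] (Complexity.ones n) (Complexity.ones n) Y sr.reverse sr (Complexity.ones C) [] [] [] (Complexity.ones L) []
  rw [hq0] at h1
  -- 2. `q0 := Q(n)`
  have h2 : Runs (pour .acc .q0) (mk [] (Complexity.ones n) (Complexity.ones n) (Complexity.ones n) Y sr.reverse sr (Complexity.ones C) (Complexity.ones q0) [] [] [] [] [] (Complexity.ones L) [])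
      (mk [] (Complexity.ones n) (Complexity.ones n) (Complexity.ones n) Y sr.reverse sr (Complexity.ones C) [] [] [] (Complexity.ones q0) [] [] (Complexity.ones L) []) (3 * q0 + 1) := by
    have := runs_pour (a := Rg.acc) (b := Rg.q0) (by decide)
      (mk [] (Complexity.ones n) (Complexity.ones n) (Complexity.ones n) Y sr.reverse sr (Complexity.ones C) (Complexity.ones q0) [] [] [] [] [] (Complexity.ones L) [])
    simpa using this
  -- 3. `q0 -= γ + 1`
  have h3 : Runs (popK .q0 (γ + 1)) (mk [] (Complexity.ones n) (Complexity.ones n) (Complexity.ones n) Y sr.reverse sr (Complexity.ones C) [] [] [] (Complexity.ones q0) [] [] (Complexity.ones L) [])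
      (mk [] (Complexity.ones n) (Complexity.ones n) (Complexity.ones n) Y sr.reverse sr (Complexity.ones C) [] [] [] (Complexity.ones (q0 - (γ + 1))) [] [] (Complexity.ones L) []) (2 * (γ + 1)) := by
    have := runs_popK .q0 (γ + 1) (mk [] (Complexity.ones n) (Complexity.ones n) (Complexity.ones n) Y sr.reverse sr (Complexity.ones C) [] [] [] (Complexity.ones q0) [] [] (Complexity.ones L) [])
    simpa [Complexity.ones, List.drop_replicate] using this
  -- 4. `n0 := n + 1`
  have h4 : Runs (push .n0 true) (mk [] (Complexity.ones n) (Complexity.ones n) (Complexity.ones n) Y sr.reverse sr (Complexity.ones C) [] [] [] (Complexity.ones (q0 - (γ + 1))) [] [] (Complexity.ones L) [])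
      (mk [] (Complexity.ones (n + 1)) (Complexity.ones n) (Complexity.ones n) Y sr.reverse sr (Complexity.ones C) [] [] [] (Complexity.ones (q0 - (γ + 1))) [] [] (Complexity.ones L) []) 1 :=
    Runs.push' (update_n0 ..)
  -- 5. `acc := Q(n + 1)`
  have h5 := runs_evalQ Q (n + 1) [] (Complexity.ones n) (Complexity.ones n) Y sr.reverse sr (Complexity.ones C) (Complexity.ones (q0 - (γ + 1))) [] [] (Complexity.ones L) []
  rw [hq1] at h5
  -- 6. `n0 := n`
  have h6 : Runs (pop .n0 skip skip skip)
      (mk [] (Complexity.ones (n + 1)) (Complexity.ones n) (Complexity.ones n) Y sr.reverse sr (Complexity.ones C) (Complexity.ones q1) [] [] (Complexity.ones (q0 - (γ + 1))) [] [] (Complexity.ones L) [])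
      (mk [] (Complexity.ones n) (Complexity.ones n) (Complexity.ones n) Y sr.reverse sr (Complexity.ones C) (Complexity.ones q1) [] [] (Complexity.ones (q0 - (γ + 1))) [] [] (Complexity.ones L) []) 2 := by
    have := runs_pop1 .n0 (mk [] (Complexity.ones (n + 1)) (Complexity.ones n) (Complexity.ones n) Y sr.reverse sr (Complexity.ones C) (Complexity.ones q1) [] [] (Complexity.ones (q0 - (γ + 1))) [] [] (Complexity.ones L) [])
    simpa [ones_succ] using this
  -- 7. `cn := C - Q(n+1)`
  have h7 : Runs (subFrom .cn .acc)
      (mk [] (Complexity.ones n) (Complexity.ones n) (Complexity.ones n) Y sr.reverse sr (Complexity.ones C) (Complexity.ones q1) [] [] (Complexity.ones (q0 - (γ + 1))) [] [] (Complexity.ones L) [])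
      (mk [] (Complexity.ones n) (Complexity.ones n) (Complexity.ones n) Y sr.reverse sr (Complexity.ones m) [] [] [] (Complexity.ones (q0 - (γ + 1))) [] [] (Complexity.ones L) []) (4 * q1 + 1) := by
    have := runs_subFrom (x := Rg.cn) (y := Rg.acc) (by decide) (Complexity.ones q1)
      (mk [] (Complexity.ones n) (Complexity.ones n) (Complexity.ones n) Y sr.reverse sr (Complexity.ones C) (Complexity.ones q1) [] [] (Complexity.ones (q0 - (γ + 1))) [] [] (Complexity.ones L) []) rfl
    simpa [Complexity.ones, List.drop_replicate, hm] using this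
  -- 8. `acc := K(n)`
  have h8 := runs_evalQ K n [] (Complexity.ones n) (Complexity.ones n) Y sr.reverse sr (Complexity.ones m) (Complexity.ones (q0 - (γ + 1))) [] [] (Complexity.ones L) []
  rw [hk] at h8
  -- 9. `kk := K(n)`
  have h9 : Runs (pour .acc .kk) (mk [] (Complexity.ones n) (Complexity.ones n) (Complexity.ones n) Y sr.reverse sr (Complexity.ones m) (Complexity.ones k) [] [] (Complexity.ones (q0 - (γ + 1))) [] [] (Complexity.ones L) [])
      (mk [] (Complexity.ones n) (Complexity.ones n) (Complexity.ones n) Y sr.reverse sr (Complexity.ones m) [] [] [] (Complexity.ones (q0 - (γ + 1))) (Complexity.ones k) [] (Complexity.ones L) []) (3 * k + 1) := by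
    have := runs_pour (a := Rg.acc) (b := Rg.kk) (by decide)
      (mk [] (Complexity.ones n) (Complexity.ones n) (Complexity.ones n) Y sr.reverse sr (Complexity.ones m) (Complexity.ones k) [] [] (Complexity.ones (q0 - (γ + 1))) [] [] (Complexity.ones L) [])
    simpa using this
  -- 10. division
  have h10 := runs_divide m k (q0 - (γ + 1)) [] (Complexity.ones n) (Complexity.ones n) (Complexity.ones n) Y sr.reverse sr [] (Complexity.ones L) []
  -- 11. `q0 := t`
  have h11 : Runs (subFrom .q0 .n0)
      (mk [] (Complexity.ones n) (Complexity.ones n) (Complexity.ones n) Y sr.reverse sr [] [] [] [] (Complexity.ones (q0 - (γ + 1) + m / k)) (Complexity.ones (m % k)) [] (Complexity.ones L) [])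
      (mk [] [] (Complexity.ones n) (Complexity.ones n) Y sr.reverse sr [] [] [] [] (Complexity.ones t) (Complexity.ones (m % k)) [] (Complexity.ones L) []) (4 * n + 1) := by
    have := runs_subFrom (x := Rg.q0) (y := Rg.n0) (by decide) (Complexity.ones n)
      (mk [] (Complexity.ones n) (Complexity.ones n) (Complexity.ones n) Y sr.reverse sr [] [] [] [] (Complexity.ones (q0 - (γ + 1) + m / k)) (Complexity.ones (m % k)) [] (Complexity.ones L) []) rfl
    simpa [Complexity.ones, List.drop_replicate, ht, tOf, hm] using this
  -- 12. take the padding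
  have h12 := runs_takeLoop t sr [] [] (Complexity.ones n) (Complexity.ones n) Y sr.reverse [] [] [] [] L (Complexity.ones (m % k)) [] []
  rw [List.append_nil, ← hC, ← hL'] at h12
  -- 13. the logarithm
  have h13 := runs_logLoop n n L' [] [] Y sr.reverse (sr.drop t) [] [] (sr.take t).reverse [] (Complexity.ones (m % k)) [] []
  rw [logN_snd n n L' le_rfl, ← hthr] at h13
  -- 14. output
  have h14 := runs_output (m % k) sr.reverse Y (sr.take t).reverse thr [] [] [] (Complexity.ones (logN n (n, L')).1)
    (sr.drop t) [] [] [] [] []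
  rw [List.reverse_reverse, List.length_reverse, List.length_take, ← hC] at h14
  refine ⟨_, (h1.seq (h2.seq (h3.seq (h4.seq (h5.seq (h6.seq (h7.seq (h8.seq (h9.seq (h10.seq (h11.seq (h12.seq
    (h13.seq h14))))))))))))).mono ?_, ?_⟩
  · simp only [bodyCost, ← hm, ← ht, ← hL', ← hthr]
    omega
  · simp only [mk_out, outList, ← hC, ← ht, ← hm, ← hL', ← hthr]

/-! #### The polynomial time bound -/

/-- **The cost is polynomial**: with all parsed sizes at most `N` and the three values at most
`Q(N+2)`, `Q(N+2)`, `K(N+2)`, parsing plus body cost at most `64 M⁴`,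
`M = N + (Q(N+2) + K(N+2) + 1) + (deg Q + deg K + γ + 2)`. [folklore] -/
theorem bodyCost_le (γ : ℕ) (Q K : Polynomial ℕ) {N n C L Y q0 q1 k : ℕ} (hn : n ≤ N) (hC : C ≤ N)
    (hL : L ≤ N) (hY : Y ≤ N) (hq0 : q0 ≤ Q.eval (N + 2)) (hq1 : q1 ≤ Q.eval (N + 2)) (hk : k ≤ K.eval (N + 2)) :
    8 * N + 3 + bodyCost γ Q K n C L Y q0 q1 k ≤
      64 * (N + (Q.eval (N + 2) + K.eval (N + 2) + 1) + (Q.natDegree + K.natDegree + γ + 2)) ^ 4 := by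
  have ha1 : Q.eval (n + 1) ≤ Q.eval (N + 2) := Complexity.TM2Iter.eval_mono Q (by omega)
  have ha2 : Q.eval (n + 1 + 1) ≤ Q.eval (N + 2) := Complexity.TM2Iter.eval_mono Q (by omega)
  have hb1 : K.eval (n + 1) ≤ K.eval (N + 2) := Complexity.TM2Iter.eval_mono K (by omega)
  unfold bodyCost tOf
  generalize Q.eval (n + 1) = a1 at ha1 ⊢
  generalize Q.eval (n + 1 + 1) = a2 at ha2 ⊢
  generalize K.eval (n + 1) = b1 at hb1 ⊢
  generalize Q.eval (N + 2) = QA at *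
  generalize K.eval (N + 2) = KA at *
  generalize Q.natDegree = dQ
  generalize K.natDegree = dK
  have ht : q0 - (γ + 1) + (C - q1) / k - n ≤ q0 + C := by
    have := Nat.div_le_self (C - q1) k; omega
  generalize q0 - (γ + 1) + (C - q1) / k - n = t at ht ⊢
  have hμ : (C - q1) % k ≤ C := (Nat.mod_le _ _).trans (Nat.sub_le _ _)
  generalize (C - q1) % k = μ at hμ ⊢
  have hmn : min t C ≤ C := min_le_right _ _
  generalize min t C = mn at hmn ⊢
  have hθ : mn + L - 3 * Nat.log 2 n ≤ C + L := by omega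
  generalize mn + L - 3 * Nat.log 2 n = θ at hθ ⊢
  -- everything is bounded by `M`
  generalize hM : N + (QA + KA + 1) + (dQ + dK + γ + 2) = M
  have hM2 : 2 ≤ M := by omega
  have p1 : (dQ + 1) * (a1 * (10 * n + 5) + 2) ≤ 14 * M ^ 3 := by
    have e : a1 * (10 * n + 5) ≤ M * (13 * M) := Nat.mul_le_mul (by omega) (by omega)
    have e' : M * (13 * M) + 2 ≤ 14 * M ^ 2 := by nlinarith
    calc (dQ + 1) * (a1 * (10 * n + 5) + 2) ≤ M * (14 * M ^ 2) := Nat.mul_le_mul (by omega) (by omega)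
      _ = 14 * M ^ 3 := by ring
  have p2 : (dQ + 1) * (a2 * (10 * (n + 1) + 5) + 2) ≤ 19 * M ^ 3 := by
    have e : a2 * (10 * (n + 1) + 5) ≤ M * (18 * M) := Nat.mul_le_mul (by omega) (by omega)
    have e' : M * (18 * M) + 2 ≤ 19 * M ^ 2 := by nlinarith
    calc (dQ + 1) * (a2 * (10 * (n + 1) + 5) + 2) ≤ M * (19 * M ^ 2) := Nat.mul_le_mul (by omega) (by omega)
      _ = 19 * M ^ 3 := by ring
  have p3 : (dK + 1) * (b1 * (10 * n + 5) + 2) ≤ 14 * M ^ 3 := by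
    have e : b1 * (10 * n + 5) ≤ M * (13 * M) := Nat.mul_le_mul (by omega) (by omega)
    have e' : M * (13 * M) + 2 ≤ 14 * M ^ 2 := by nlinarith
    calc (dK + 1) * (b1 * (10 * n + 5) + 2) ≤ M * (14 * M ^ 2) := Nat.mul_le_mul (by omega) (by omega)
      _ = 14 * M ^ 3 := by ring
  have p4 : (C - q1 + 2) * (10 * k + 10) ≤ 20 * M ^ 2 :=
    calc (C - q1 + 2) * (10 * k + 10) ≤ (2 * M) * (10 * M) := Nat.mul_le_mul (by omega) (by omega)
      _ = 20 * M ^ 2 := by ring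
  have p5 : n * (7 * n + 18) ≤ 16 * M ^ 2 :=
    calc n * (7 * n + 18) ≤ M * (16 * M) := Nat.mul_le_mul (by omega) (by omega)
      _ = 16 * M ^ 2 := by ring
  have f1 : 2 * M ^ 3 ≤ M ^ 4 := by
    calc 2 * M ^ 3 ≤ M * M ^ 3 := Nat.mul_le_mul_right _ hM2
      _ = M ^ 4 := by ring
  have f2 : 2 * M ^ 2 ≤ M ^ 3 := by
    calc 2 * M ^ 2 ≤ M * M ^ 2 := Nat.mul_le_mul_right _ hM2
      _ = M ^ 3 := by ring
  have f3 : 2 * M ≤ M ^ 2 := by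
    calc 2 * M ≤ M * M := Nat.mul_le_mul_right _ hM2
      _ = M ^ 2 := by ring
  omega

/-- **The time polynomial** `64 (X + (Q(X+2) + K(X+2) + 1) + deg Q + deg K + γ + 2)⁴`. [folklore] -/
noncomputable def timePoly (γ : ℕ) (Q K : Polynomial ℕ) : Polynomial ℕ :=
  Polynomial.C 64 * (Polynomial.X + (Q.comp (Polynomial.X + 2) + K.comp (Polynomial.X + 2) + 1) +
    Polynomial.C (Q.natDegree + K.natDegree + γ + 2)) ^ 4

/-- Evaluation of the time polynomial. [folklore] -/
theorem eval_timePoly (γ : ℕ) (Q K : Polynomial ℕ) (N : ℕ) :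
    (timePoly γ Q K).eval N =
      64 * (N + (Q.eval (N + 2) + K.eval (N + 2) + 1) + (Q.natDegree + K.natDegree + γ + 2)) ^ 4 := by
  simp [timePoly, Polynomial.eval_comp]

end LPD

open LPD in
/-- **The function computed by the preprocessing program** (its functional semantics on every
input: parse, then `LPD.outList` of the parsed data). [folklore] -/
noncomputable def lpPreFn (γ : ℕ) (Q K : Polynomial ℕ) (z : List Bool) : List Bool :=
  LPD.outList γ (LPD.parse1Spec z 0).1 (LPD.parse2Spec (LPD.parse1Spec z 0).2 [] 0).1
    (LPD.parse2Spec (LPD.parse1Spec z 0).2 [] 0).2.1 (LPD.parse2Spec (LPD.parse1Spec z 0).2 [] 0).2.2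
    (Q.eval (LPD.parse1Spec z 0).1) (Q.eval ((LPD.parse1Spec z 0).1 + 1)) (K.eval (LPD.parse1Spec z 0).1)

namespace LPD

open Complexity.Com

/-- **The preprocessing program computes `lpPreFn` within the time polynomial.** [folklore] -/
theorem runs_prog (γ : ℕ) (Q K : Polynomial ℕ) (z : List Bool) :
    ∃ R', Runs (prog γ Q K) (Complexity.Regs.init Rg.inp z) R' ((timePoly γ Q K).eval z.length) ∧
      R' .out = lpPreFn γ Q K z := by
  rw [init_eq]
  have hp : Runs parse1 (mk z [] [] [] [] [] [] [] [] [] [] [] [] [] [] [])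
      (parsed (parse1Spec z 0).1 (parse1Spec z 0).2 [] [] [] [] [] []) (8 * z.length + 3) := runs_parse1 z 0 [] [] [] [] [] []
  obtain ⟨R', hb, hout⟩ := runs_body γ Q K (parse1Spec z 0).1 (parse2Spec (parse1Spec z 0).2 [] 0).1
    (parse2Spec (parse1Spec z 0).2 [] 0).2.1 (parse2Spec (parse1Spec z 0).2 [] 0).2.2 _ _ _ rfl rfl rfl
  refine ⟨R', (hp.seq hb).mono ?_, hout⟩
  rw [eval_timePoly]
  have h1 := parse1Spec_le z 0
  have h2 := parse2Spec_le (parse1Spec z 0).2 [] 0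
  simp only [List.length_nil, Nat.zero_add] at h1 h2
  exact bodyCost_le γ Q K (N := z.length) (by omega) (by omega) (by omega) (by omega)
    (Complexity.TM2Iter.eval_mono Q (by omega)) (Complexity.TM2Iter.eval_mono Q (by omega)) (Complexity.TM2Iter.eval_mono K (by omega))

end LPD

/-- **The preprocessing of the padding distinguisher is polynomial time**: `lpPreFn γ Q K ∈ FP`.
[cite: AroraBarakCC2009, §1.3] -/
theorem lpPreFn_mem_FP (γ : ℕ) (Q K : Polynomial ℕ) : lpPreFn γ Q K ∈ Complexity.FP :=
  Complexity.Com.mem_FP (LPD.prog γ Q K) LPD.Rg.inp LPD.Rg.out (LPD.timePoly γ Q K) (lpPreFn γ Q K) fun z => by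
    obtain ⟨R', h, hout⟩ := LPD.runs_prog γ Q K z
    exact ⟨R', Or.inl h, hout⟩

/-- **`lpPreFn` on a well-formed input `⟨a, ⟨y, r⟩⟩`**: with `n = |a|`, `C = |r|`,
`t = (Q(n) - γ - 1 + ⌊(C - Q(n+1)) / K(n)⌋) - n`, `κ = (C - Q(n+1)) mod K(n)`, `x = y ‖ r ↾ t` and
`ρ = r ⇂ (C - κ)` (the last `κ` coins), the output is `⟨1^{|x| - 3⌊log₂ n⌋}, ⟨x, ρ⟩⟩`. [folklore] -/
theorem lpPreFn_boolPair (γ : ℕ) (Q K : Polynomial ℕ) (a y r : List Bool) :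
    lpPreFn γ Q K (Complexity.boolPair a (Complexity.boolPair y r)) =
      Complexity.boolPair (Complexity.ones ((y ++ r.take (LPD.tOf γ a.length r.length (Q.eval a.length) (Q.eval (a.length + 1))
          (K.eval a.length))).length - 3 * Nat.log 2 a.length))
        (Complexity.boolPair (y ++ r.take (LPD.tOf γ a.length r.length (Q.eval a.length) (Q.eval (a.length + 1)) (K.eval a.length)))
          (r.drop (r.length - (r.length - Q.eval (a.length + 1)) % K.eval a.length))) := by
  rw [lpPreFn, LPD.parse1Spec_boolPair, Nat.zero_add]
  simp only [LPD.parse2Spec_boolPair, List.append_nil, Nat.zero_add]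
  simp only [LPD.outList, List.reverse_reverse, List.take_reverse, LPD.boolPair_eq, LPD.dbl_append, Complexity.Com.dbl_ones,
    List.length_append, List.length_take, List.append_assoc]
  congr 3
  omega

end Literature.Computability.Cryptography
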